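import Literature.MathematicalPhysics.QuantumFieldTheory.Balaban1983to89.B16RLeafRecord11
import Literature.MathematicalPhysics.QuantumFieldTheory.Balaban1983to89.B14NodeKnitRecord12R
import Literature.MathematicalPhysics.QuantumFieldTheory.Balaban1983to89.Node00.RStepProvisosOfRecord
import Literature.MathematicalPhysics.QuantumFieldTheory.Balaban1983to89.Node00.Record12ResidualsSlots

/-!
# `Balaban1983to89.B16RLeafRecord12` — YM-DAG nodes N13∕N11 · the 𝐑-LEAF OF RECORD AT STAGE 12, `ROpLeaf (VOfRecord₁₂ θ p)` ([Balaban1988Convergent]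
# p. 244 ∕ Thm 2 p. 263 «𝐑𝐓ρ_k has the §2 form at k+1»; [Balaban1989LargeFieldII] Thm 1 p. 355: what [B16] delivers), INHABITED ON THE SELECTOR-OF-RECORD
# BRANCH (idempotent selectors moving only 𝐓-absent sequences; the identity selector included) — contentful at Stage 12 —, its general-selector socket PER
# PRESENT SEQUENCE, and THE N11∕N13 JUNCTION COMPOSED BY NAME: Theorem 1 [III] at the Stage-12 objects of record, the node `Dag.B14_main`, and the route's
# (B)-face first conjunct `B16.Thm1Printed (datumOfRecord₁₂ θ h).C` FROM THE THEOREM OF p. 245 ALONE on that branch (resp. + the absorption hypothesis in general)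

statement-level bookkeeping over published theorems with citation tags; kernel-checked compositions of tree theorems;
nothing here is a claim about the Yang–Mills mass gap.

Cell `pub-ymgap` (HUMAN RULING D-0062, Track A), seat `pub-ymgap-dag-n11-e` (R134 fan-out row N11∕s3, director-ym verbatim: «`ThmP245Printed` :375 via `rOperation`
from N13's `ROpLeaf` (pairs with n13-c)»), generation 3; filed `--supports` the route's K1′ `StabilityBAtRecordR12e` AS A HELPER (count-neutral).  [III] =
[Balaban1988Convergent], [IV] = [Balaban1989LargeFieldI], [B16] = [Balaban1989LargeFieldII].  THIS IS THE STAGE-12 TWIN of seat dag-n13-c's `…B16RLeafRecord11`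
(trigger t1 of that seat's HANDOFF: «`Node00/Record12.lean` ACCEPTED ⇒ twin»; the n13-c lineage being unseated since, the N11 seat whose row PAIRS with it files the
twin together with the junction its own Stage-12 module `…B14NodeKnitRecord12R` was waiting for).
BY NAME and UNCHANGED (imported, never restated): `…B16RLeafRecord11` §1∕§7 — the GENERIC (0.3) 𝐑-factor algebra of def-R's `rstepOfSel` ∕ `rstepSlotOfRecord`
(`rstepSlotOfRecord_of_not_mem_range`, `rstepSlotOfRecord_of_forall_sel_eq`, `le_rstepSlotOfRecord_of_sel_self`); `…Node00.RStepProvisosOfRecord` (def-R: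
`rterm_eq_zero_of_TexpA`); `…Node00.RStepRepr218` (`rstepOfSel_TexpA`, `rratio`, `rterm`); `…Node00.Record12` (node00-def-T: `Stage12Params`, `Provisos₁₂` —
INHABITABLE, unlike `Provisos₁₁` (`not_provisos₁₁`) —, `Admissible`, `SLaw₁₂`∕`TLaw₁₂`, `sLaw₁₂_iff`∕`tLaw₁₂_iff`, `HasSect2FormAEZ`∕`TAEZ` with the WHOLE-SLOT
DICHOTOMY «slot absent (`= 0`) or §2 identity a.e. on the χ-support», `HasSect2FormTAEZ.toFormAEZ_succ`, `settingOfRecord₁₂`, `WtOfRecord₁₂`, `UbgOfRecord₁₂`,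
`VOfRecord₁₂`, `rOpLeaf_VOfRecord₁₂_iff`, `datumOfRecord₁₂`, `flow_g_datumOfRecord₁₂`, `IsRecordOfRecord₁₂C`, `construction_eq_of_isRecordOfRecord₁₂C`);
`…Node00.RepTowerOfRecord` (`slotsOfRecord_succ`, `slotsTOfRecord`); `…Node00.Record12ResidualsSlots` (node00-def-K0b: `slotsTOfRecord_succ_eq_zero_of_forall_ne` —
sequences outside the image of the index map `σOfRecord` have the zero 𝐓-slot; v1.1); `…B14NodeKnitRecord12R` (this seat, g2: `rOperation_iff_rOpLeaf₁₂`, `rOpLeaf₁₂_iff_rAssumedP244`,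
`sLaw₁₂_all_of_rAssumedP244`, `densitiesDescribed_at_record₁₂_of_rOpLeaf`, `thm1Printed_datumOfRecord₁₂_of_laws_rAssumedP244`, `thmP245PrintedI_at_record₁₂_iff_laws`).

WHAT CHANGED AT STAGE 12 FOR THE LEAF (why the twin is not a copy).  (a) At Stage 11 every theorem under `(h : θ.Provisos₁₁)` was VACUOUS (`Node00.not_provisos₁₁`);
`Provisos₁₂` drops the uninhabitable field, so §2's inhabitation below is the first CONTENTFUL inhabitation of an 𝐑-leaf at a V of record.  (b) The (S)∕(T) pins
now carry the whole-slot dichotomy: an ABSENT 𝐓-slot (`slotT_{k+1}(s′) = 0`) passes to an absent post-𝐑 slot (`slot_{k+1}(s′) = slotT_{k+1}(s′)·(𝐑-factor) = 0`,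
§1), and a sequence OFF THE RANGE of the selector has the post-𝐑 slot `0` (empty fibre, §1) — so at Stage 12 the leaf NO LONGER forces selectors to be onto:
n13-c's §5∕§6 census of the Stage-11 file (leaf ∧ `TLaw k` ⇒ `ppSel (k+1)` surjective) RETIRES into the zero disjunct, exactly as its author predicted, and the
general-selector socket needs the absorption of the 𝐑-factor ONLY AT THE PRESENT SEQUENCES `s′ ∈ range (θ.ppSel p g (k+1))` (§3).  (c) THE SELECTOR OF RECORD
(director-ym LINE №114 (α), 2026-08-26: the K0′ witness's selector is RE-PINNED from the identity to the selector OF RECORD — range = the PRESENT sequences,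
absent sequences carried onto present ones): §2 is written for exactly that shape — an IDEMPOTENT selector that MOVES ONLY 𝐓-ABSENT sequences —, the identity
selector being its sub-case with nothing moved (§1's `rstepOfSel_TexpA_of_fix_of_absent`: at a fixed point onto which only zero slots are selected the 𝐑-factor is
`1` on the support, the selected absent sequences contributing `∫⌈0 ∕ ∫⌈t_{s′} = 0`).  Whether the re-pinned witness satisfies §2's two selector clauses or only
§3's socket is for its author (node00-def-K0a) to say; no theorem here keys to a particular `θ`.

CONTENTS (0 `sorry`, 0 `def`, standard axioms; every ingredient BY NAME).
§1 (kernel, def-R's 𝐑-step ON SLOTS — generic over `rstepOfSel`, at the slot operation of record, and at the Stage-12 slot families): `rstepOfSel_TexpA_of_eq_zero`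
   ∕ `rstepSlotOfRecord_eq_zero_of_eq_zero` (a zero slot stays zero under 𝐑) · `rstepOfSel_TexpA_of_fix_of_absent` ∕ `rstepSlotOfRecord_of_fix_of_absent` (fixed
   point + only absent sequences selected onto it ⇒ slot unchanged on the χ-support) · `slotsOfRecord₁₂_succ_eq_zero_of_not_mem_range` ·
   `slotsOfRecord₁₂_succ_eq_zero_of_slotsT_eq_zero` · `slotsOfRecord₁₂_succ_eq_slotsT_of_forall_sel_eq` (identity selector) ·
   `slotsOfRecord₁₂_succ_eq_slotsT_of_fix_of_absent` (selector of record) — the last two under the support-form proviso `Provisos₁₂.base.rstep` —,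
   `slotsT_le_slotsOfRecord₁₂_succ_of_sel_self` (on a fixed point the 𝐑-step never decreases the slot: the 𝐑-factor [B16] absorbs is `≥ 1` on the support).
§2 ★ THE LEAF INHABITED ON THE SELECTOR-OF-RECORD BRANCH: `sLaw₁₂_succ_of_tLaw₁₂_of_idem_of_absent` (`TLaw₁₂ k → SLaw₁₂ (k+1)` with the SAME witnesses: laws by
   p. 262 [III] under the signs `0 ≤ β` (admissibility), `0 ≤ κ, E₀, B₀`, `0 ≤ g_{k+1}` — displayed —, off-range slots absent, absent 𝐓-slots to absent slots, the
   a.e. identity at the present sequences transported by §1) · `rOpLeaf_VOfRecord₁₂_of_idem_of_absent` · `…_of_inInterval` (`0 ≤ g_{k+1}` from the coupling window of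
   the run at the datum of record) · the identity-selector sub-case `sLaw₁₂_succ_of_tLaw₁₂_of_forall_sel_eq` ∕ `rOpLeaf_VOfRecord₁₂_of_forall_sel_eq` ∕
   `…_of_inInterval` · world forms `rOperation_leavesP_of_idem_of_absent₁₂` ∕ `rOperation_leavesP_of_forall_sel_eq₁₂` (the run's `rOperation` leaf at a Stage-12-bound
   run — what N11 ∕ N13 ∕ N24 knits read).
§3 THE GENERAL-SELECTOR SOCKET PER PRESENT SEQUENCE: `sLaw₁₂_succ_of_tLaw₁₂_of_absorbPresent`, `rOpLeaf_VOfRecord₁₂_of_absorbPresent` — the leaf from ONE displayed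
   hypothesis: the witnesses of the 𝐓-image form are re-presented by law-abiding terms at `k+1` satisfying the dichotomy AT THE PRESENT SEQUENCES ONLY ([IV] Prop. 1
   (1.1)–(1.2) p. 177 with [B16] (1.100)–(1.101) pp. 390–391 read at the objects of record — NOT asserted; off-range sequences are discharged by §1).
§4 ★ THE N11∕N13 JUNCTION COMPOSED BY NAME (this seat's row): on the §2 branch N13's 𝐑-product `ROpLeaf (VOfRecord₁₂ θ p)` is §2's THEOREM, so —
   `sLaw₁₂_all_of_thmP245_of_idem_of_absent` ∕ `…_of_forall_sel_eq` — THEOREM 1 [III] at the Stage-12 objects of record (`∀ k ≤ K, SLaw₁₂ θ p k`) follows from N11's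
   ONE slot (S1ᵀ) = the Theorem of p. 245 at the objects of record (`∀ k < K, SLaw₁₂ θ p k → TLaw₁₂ θ p k`) ALONE, plus the displayed signs
   (`…B14NodeKnitRecord12R.sLaw₁₂_all_of_rAssumedP244` fed by §2); `densitiesDescribed_at_record₁₂_of_idem_of_absent` (at a world bound to the datum);
   `b14_main_at_record₁₂_of_idem_of_absent` ∕ `…_of_forall_sel_eq` (THE NODE `Dag.B14_main (leavesP w P)` with NO 𝐑-reading hypothesis: the `0 ≤ g_{k+1}` sign comes
   from the node's own interval antecedent, the 𝐑 antecedent is REDUNDANT on this branch — received and not used, said here once);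
   `b14_main_of_isRecordOfRecord₁₂C_datum_of_idem_of_absent` (the same in the binder shape of the route's K1′ stub `stub_nodes12`: a world with
   `IsRecordOfRecord₁₂C F N (datumOfRecord₁₂ θ h) w`); `thm1Printed_datumOfRecord₁₂_of_laws_of_idem_of_absent` ∕ `…_of_forall_sel_eq` ∕ `…_of_thmP245I_of_idem_of_absent`
   (THE ROUTE's K1′ (B)-FACE FIRST CONJUNCT `B16.Thm1Printed (datumOfRecord₁₂ F N θ h).C` from the Theorem of p. 245 along the windowed runs ALONE — law currency ∕
   [III]'s own slot name `B14.ThmP245PrintedI` for any `T`-family agreeing with the tower on the trajectory); and the general-selector twins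
   `sLaw₁₂_all_of_thmP245_of_absorbPresent`, `thm1Printed_datumOfRecord₁₂_of_laws_of_absorbPresent` ((S1ᵀ) + the §3 absorption hypothesis: how the two nodes'
   printed products compose at a record whose 𝐑 is genuine).

HONEST FRAMING — READ THIS BEFORE CITING §2 OR §4.  Count-neutral kernel bookkeeping; nothing of Bałaban's is asserted: not Theorem 1 [B16], not (1.1)–(1.2) [IV],
not (1.100)–(1.101) [B16], not the Theorem of p. 245 ∕ Thms 1–2 [III], no estimate; `(h : θ.Provisos₁₂ F N)` (K0′-type content), admissibility, the signs
`0 ≤ κ, E₀, B₀`, the non-negative history ∕ coupling window, the two selector clauses of §2 and (S1ᵀ) are DISPLAYED hypotheses.  THE §2 BRANCH IS A BRANCH ON WHICH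
𝐑 INTEGRATES NOTHING OUT OF A PRESENT TERM (seat dag-n13-c's located «𝐑 = 1» reading at Stage 11, standing, extended to selectors that move only absent sequences):
each present slot is multiplied by `∫⌈t_{s′}∕∫⌈t_{s′} + Σ(zero ratios) = 1` on its support, so the leaf's content `TLaw₁₂ k → SLaw₁₂ (k+1)` is the p. 262 weakening of
the 𝐓-image laws and NOTHING of [B16]'s 𝐑-construction is exercised.  CONSEQUENCE FOR READERS OF K0′∕K1′ (LOCATED, not a claim, not a second gap): at a record on
this branch ALL of Theorem 1's analytic burden sits in N11's slot (S1ᵀ) (`∀ k < K, SLaw₁₂ k → TLaw₁₂ k`: [III] Sects. 1–3 with Thm 2 at the objects of record, for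
EVERY `k < K`), whereas print distributes it between 𝐓 ([III] Thm 2) and 𝐑 ([B16] Thm 1: the renormalization of the large-field boundary terms after `Nmem` steps,
[IV] p. 177 (i)–(ii)); whether (S1ᵀ) holds at such a record at the levels where print's 𝐑 is NOT trivial is exactly what print's 𝐑 exists to secure — the discharge
question of N11∕N13, untouched here.  At a record with a genuine 𝐑 the currency is §3∕§4's `…absorbPresent`.  N11 and N13 are NOT discharged by this file.  One
finite four-torus programme at fixed `ε`, Bałaban AS PRINTED with locators; nothing continuum ∕ ℝ⁴ ∕ OS ∕ mass gap ∕ Clay.  No `sorry`, no `def`, no `instance`,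
no `notation`.
Sources: T. Bałaban, CMP **119** (1988) 243–285 [III] p. 244, Theorem p. 245, (2.18) p. 257, (2.21)–(2.23) p. 258, Thm 1 p. 262, remark p. 262, Thm 2 p. 263,
(3.24)–(3.25) p. 270; CMP **122** (1989) 175–202 [IV] (0.2)–(0.4) p. 176, (i)–(ii) p. 177, Prop. 1 (1.1)–(1.2) p. 177; CMP **122** (1989) 355–392 [B16] Thm 1
p. 355, (1.100)–(1.101) pp. 390–391.

v1.1 (same seat; APPEND-ONLY — every v1.0 declaration byte-identical; one import added): §5 THE SELECTOR OF RECORD — §2∕§4's «moved ⇒ zero 𝐓-slot» clause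
DISCHARGED in print's own terms by node00-def-K0b's `slotsTOfRecord_succ_eq_zero_of_forall_ne` (a sequence outside the image of the index map `σOfRecord` —
no label `(P, Q, R, S)` produces it — has step weight `0`, hence the zero 𝐓-slot): `slotsTOfRecord₁₂_succ_eq_zero_of_forall_σ_ne`,
`sLaw₁₂_succ_of_tLaw₁₂_of_idem_of_moveAbsent`, `rOpLeaf_VOfRecord₁₂_of_idem_of_moveAbsent(_of_inInterval)`, `sLaw₁₂_all_of_thmP245_of_idem_of_moveAbsent`,
`b14_main_at_record₁₂_of_idem_of_moveAbsent`, `thm1Printed_datumOfRecord₁₂_of_laws_of_idem_of_moveAbsent` — the hypotheses a selector OF RECORD in director-ym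
LINE №114 (α)'s sense («range = the PRESENT sequences») is expected to meet: idempotent, and every moved sequence σ-absent.  Still θ-generic: no theorem keys to
the K0′ witness; whether the re-pinned `theta12OfRecord` meets the two clauses is node00-def-K0a's word.
-/

noncomputable section

open MeasureTheory
open scoped BigOperators Matrix.Norms.L2Operator

namespace Literature.MathematicalPhysics.QuantumFieldTheory.Balaban1983to89.B16RLeafRecord12

open T4Continuum T4DatumAssembly Node00 B14.Eq218Concrete DagBinding
open B16RLeafRecord11 B14NodeKnitRecord12R

variable (F : T4Family) (N : ℕ) [NeZero N]

/-! ## §1  def-R's (0.3) 𝐑-step ON SLOTS at the Stage-12 slot families: zero slots, off-range sequences, fixed points (identity ∕ selector of record), monotonicity -/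

section RStep

variable {P : Params} {G : Type*} [GaugeGroup G] [MeasurableSpace G] [HaarData G] {j : ℕ}

/-- **A ZERO SLOT STAYS ZERO UNDER THE (0.3) 𝐑-STEP** (generic over def-R's `rstepOfSel`, any selector, any fibre data): `(𝐓e^A)′(a′) = (𝐓e^A)(a′)·Σ(…) =
0·Σ(…)` — an ABSENT term stays absent ((0.3) re-indexed by `Z″`).  The `DecidableEq (PBond …)` instance is an implicit binder (unified with the caller's).
[cite: Balaban1989LargeFieldI, (0.3) p.176] -/
theorem rstepOfSel_TexpA_of_eq_zero {hP : DecidableEq (PBond P j)} (r : Step.Repr218 P G j) (sel : r.Adm → r.Adm)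
    (fib : r.Adm → Finset (PBond P j)) (a' : r.Adm) (h0 : r.TexpA a' = 0) (V : GaugeField P j G) :
    (rstepOfSel r sel fib).TexpA a' V = 0 := by
  rw [rstepOfSel_TexpA, h0, Pi.zero_apply, zero_mul]

open Classical in
/-- **ON A FIXED POINT `a′` OF THE SELECTOR ONTO WHICH ONLY ABSENT TERMS ARE SELECTED, THE 𝐑-STEPPED SLOT IS UNCHANGED ON THE χ-SUPPORT** (generic): with
`sel a′ = a′` and `(𝐓e^A)(a) = 0` for every OTHER `a` with `sel a = a′`, the 𝐑-factor `Σ_{a : sel a = a′} ∫⌈_{Z′(a)} t_a ∕ ∫⌈_{Z′(a)} t_{a′}` reduces to its diagonal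
term (`t_a = χ(a)·0`, `∫⌈ 0 = 0` — def-R's `rterm_eq_zero_of_TexpA`, `fibreIntegral_zero_fun`), which is `1` where `∫⌈ t_{a′} ≠ 0`; where it vanishes, the
support-form proviso and `χ(a′)(V) ≠ 0` give `(𝐓e^A)(a′)(V) = 0` and `0·(0∕0) = 0`.  The identity selector is the case with no other `a`; the selector OF RECORD
(director-ym LINE №114 (α): range = the PRESENT sequences, absent ones carried onto present ones) is the case this lemma is written for.
[cite: Balaban1989LargeFieldI, (0.3) p.176, p.177 (i)–(ii)] -/
theorem rstepOfSel_TexpA_of_fix_of_absent {hP : DecidableEq (PBond P j)} (r : Step.Repr218 P G j) (sel : r.Adm → r.Adm)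
    (fib : r.Adm → Finset (PBond P j)) (a' : r.Adm) (hfix : sel a' = a') (habs : ∀ a, sel a = a' → a ≠ a' → r.TexpA a = 0)
    (V : GaugeField P j G) (hsupp : B15.BasicStep.fibreIntegral (fib a') (rterm r a') V = 0 → rterm r a' V = 0) (hχ : r.χ a' V ≠ 0) :
    (rstepOfSel r sel fib).TexpA a' V = r.TexpA a' V := by
  rw [rstepOfSel_TexpA]
  have hmem : a' ∈ Finset.univ.filter (fun a => sel a = a') := by simp [hfix]
  rw [Finset.sum_eq_single_of_mem a' hmem ?_]
  · by_cases h0 : B15.BasicStep.fibreIntegral (fib a') (rterm r a') V = 0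
    · have hT : r.TexpA a' V = 0 := by
        rcases mul_eq_zero.1 (hsupp h0) with h | h
        · exact absurd h hχ
        · exact h
      rw [hT, zero_mul]
    · rw [rratio, div_self h0, mul_one]
  · intro a ha hne
    have hsel : sel a = a' := (Finset.mem_filter.1 ha).2
    have hz : rterm r a = fun _ => 0 :=
      rterm_eq_zero_of_TexpA r a fun W => by rw [habs a hsel hne, Pi.zero_apply]
    rw [rratio, hz]
    simp [B15.BasicStep.fibreIntegral, MeasureTheory.lmarginal]

end RStep

section SlotOp

variable {F N} (ν : Stage7Numerics) (τ : TowerNumerics)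

/-- **A ZERO SLOT STAYS ZERO UNDER `R` OF RECORD** (ARBITRARY slot family `f`, the selector and fibre bond sets of record): an ABSENT term of `𝐓ρ_k` is absent
from `ρ_{k+1}` — the clause the Stage-12 dichotomy keys BY VALUE. [cite: Balaban1989LargeFieldI, (0.3) p.176] -/
theorem rstepSlotOfRecord_eq_zero_of_eq_zero (ppSel : PpSelOfRecord F ν τ.M) (p : B12.RunParams) (g : ℕ → ℝ) (k : ℕ)
    (f : TexpASlot F N ν τ.M p g k) (s' : SeqOfRecord F ν τ.M g p.K k) (hf : f s' = 0) (V : GaugeField (F.P p.K) k (SU N)) :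
    rstepSlotOfRecord F N ν τ ppSel p g k f s' V = 0 := by
  unfold rstepSlotOfRecord rstepSlot
  exact rstepOfSel_TexpA_of_eq_zero (sliceOfRecord F N ν τ.M p g k f) (ppSel p g k) (fibOfSeq F ν τ p g k) s' hf V

/-- `R` of record as a slot operation LEAVES THE SLOT UNCHANGED on the `χ_k(s′)`-support AT A FIXED POINT `s′` OF THE SELECTOR ONTO WHICH ONLY ZERO SLOTS ARE
SELECTED (ARBITRARY slot family `f`; support-form proviso at `s′` stated with the caller's `DecidableEq (PBond …)` instance, bridged by subsingleton-`convert`).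
[cite: Balaban1989LargeFieldI, (0.3) p.176] -/
theorem rstepSlotOfRecord_of_fix_of_absent (ppSel : PpSelOfRecord F ν τ.M) (p : B12.RunParams) (g : ℕ → ℝ) (k : ℕ)
    (f : TexpASlot F N ν τ.M p g k) (s' : SeqOfRecord F ν τ.M g p.K k) (hfix : ppSel p g k s' = s')
    (habs : ∀ a, ppSel p g k a = s' → a ≠ s' → f a = 0) (V : GaugeField (F.P p.K) k (SU N))
    (hsupp : B15.BasicStep.fibreIntegral (fibOfSeq F ν τ p g k s')
        (fun U => chiSeqOfRecord F N ν τ.M g p.K k s' U * f s' U) V = 0 →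
      chiSeqOfRecord F N ν τ.M g p.K k s' V * f s' V = 0)
    (hχ : chiSeqOfRecord F N ν τ.M g p.K k s' V ≠ 0) :
    rstepSlotOfRecord F N ν τ ppSel p g k f s' V = f s' V := by
  unfold rstepSlotOfRecord rstepSlot
  refine rstepOfSel_TexpA_of_fix_of_absent (sliceOfRecord F N ν τ.M p g k f) (ppSel p g k) (fibOfSeq F ν τ p g k) s' hfix habs V
    ?_ hχ
  intro h0
  apply hsupp
  convert h0 using 2
  rfl

end SlotOp

section AtRecordSlots

variable (θ : Stage12Params F N) (p : B12.RunParams)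

/-- **AT THE STAGE-12 RECORD, OFF THE RANGE OF `θ.ppSel p g (k+1)` THE POST-𝐑 SLOT OF `ρ_{k+1}` VANISHES IDENTICALLY** (`slotsOfRecord_succ` + n13-c's generic
empty-fibre lemma): the term is ABSENT from `ρ_{k+1}` — at Stage 12 this is the zero disjunct of the (S)-pin, no longer a defect. [cite: Balaban1989LargeFieldI, (0.3) p.176; Balaban1988Convergent, (2.17)–(2.18) p.257] -/
theorem slotsOfRecord₁₂_succ_eq_zero_of_not_mem_range (k : ℕ)
    (s' : SeqOfRecord F θ.ν θ.τ9.M (gOfRecord₁₀ F N θ.toStage9Params p) p.K (k + 1))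
    (hs' : s' ∉ Set.range (θ.ppSel p (gOfRecord₁₀ F N θ.toStage9Params p) (k + 1))) :
    slotsOfRecord F N θ.ν θ.τ9 (EOfRecord₁₀ F N θ.toStage9Params) (wOfRecord₉ F N θ.toStage9Params) θ.ppSel p
        (gOfRecord₁₀ F N θ.toStage9Params p) (k + 1) s' = 0 := by
  funext V
  rw [slotsOfRecord_succ]
  exact rstepSlotOfRecord_of_not_mem_range θ.ν θ.τ9 θ.ppSel p _ (k + 1) _ s' hs' V

/-- **AN ABSENT 𝐓-SLOT GIVES AN ABSENT POST-𝐑 SLOT**: if the pre-𝐑 slot of `𝐓ρ_k` at `s′` is the zero function, so is the post-𝐑 slot of `ρ_{k+1}` at `s′` (§1's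
generic zero lemma at the slot recursion of record) — the propagation of the zero disjunct of the (T)-pin to the (S)-pin one 𝐑-step later. [cite: Balaban1989LargeFieldI, (0.3) p.176; Balaban1988Convergent, (3.24)–(3.25) p.270] -/
theorem slotsOfRecord₁₂_succ_eq_zero_of_slotsT_eq_zero (k : ℕ)
    (s' : SeqOfRecord F θ.ν θ.τ9.M (gOfRecord₁₀ F N θ.toStage9Params p) p.K (k + 1))
    (h0 : slotsTOfRecord F N θ.ν θ.τ9 (EOfRecord₁₀ F N θ.toStage9Params) (wOfRecord₉ F N θ.toStage9Params) θ.ppSel p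
      (gOfRecord₁₀ F N θ.toStage9Params p) (k + 1) s' = 0) :
    slotsOfRecord F N θ.ν θ.τ9 (EOfRecord₁₀ F N θ.toStage9Params) (wOfRecord₉ F N θ.toStage9Params) θ.ppSel p
        (gOfRecord₁₀ F N θ.toStage9Params p) (k + 1) s' = 0 := by
  funext V
  rw [slotsOfRecord_succ]
  exact rstepSlotOfRecord_eq_zero_of_eq_zero θ.ν θ.τ9 θ.ppSel p _ (k + 1) _ s' h0 V

/-- **AT THE STAGE-12 RECORD WITH AN IDENTITY SELECTOR AT LEVEL `k+1`, THE POST-𝐑 SLOT OF `ρ_{k+1}` IS THE PRE-𝐑 SLOT OF `𝐓ρ_k` ON THE `χ_{k+1}(s′)`-SUPPORT**,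
under the provisos (`Provisos₁₂.base.rstep`: def-R's (0.3) provisos of the pre-𝐑 tower of record in support form — where the diagonal fibre integral vanishes so
does the piece; `0·(0∕0) = 0`).  The Stage-12 twin of n13-c's `slotsOfRecord_succ_eq_slotsT_of_forall_sel_eq`, now under INHABITABLE provisos.
[cite: Balaban1989LargeFieldI, (0.3) p.176; Balaban1988Convergent, (3.24)–(3.25) p.270] -/
theorem slotsOfRecord₁₂_succ_eq_slotsT_of_forall_sel_eq (h : θ.Provisos₁₂ F N) (k : ℕ) (hk : k < p.K)
    (hsel : ∀ a, θ.ppSel p (gOfRecord₁₀ F N θ.toStage9Params p) (k + 1) a = a)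
    (s' : SeqOfRecord F θ.ν θ.τ9.M (gOfRecord₁₀ F N θ.toStage9Params p) p.K (k + 1)) (V : GaugeField (F.P p.K) (k + 1) (SU N))
    (hχ : chiSeqOfRecord F N θ.ν θ.τ9.M (gOfRecord₁₀ F N θ.toStage9Params p) p.K (k + 1) s' V ≠ 0) :
    slotsOfRecord F N θ.ν θ.τ9 (EOfRecord₁₀ F N θ.toStage9Params) (wOfRecord₉ F N θ.toStage9Params) θ.ppSel p
        (gOfRecord₁₀ F N θ.toStage9Params p) (k + 1) s' V
      = slotsTOfRecord F N θ.ν θ.τ9 (EOfRecord₁₀ F N θ.toStage9Params) (wOfRecord₉ F N θ.toStage9Params) θ.ppSel p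
          (gOfRecord₁₀ F N θ.toStage9Params p) (k + 1) s' V := by
  rw [slotsOfRecord_succ]
  refine rstepSlotOfRecord_of_forall_sel_eq θ.ν θ.τ9 θ.ppSel p _ (k + 1) hsel _ s' V ?_ hχ
  have H := (h.base.rstep p k hk).2.2.2 s' V
  change B15.BasicStep.fibreIntegral (fibOfSeq F θ.ν θ.τ9 p (gOfRecord₁₀ F N θ.toStage9Params p) (k + 1) s')
      (rterm (repr218OfRecord F N θ.ν θ.τ9.M (slotsTOfRecord F N θ.ν θ.τ9 (EOfRecord₁₀ F N θ.toStage9Params)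
        (wOfRecord₉ F N θ.toStage9Params) θ.ppSel) p (gOfRecord₁₀ F N θ.toStage9Params p) (k + 1))
        (θ.ppSel p (gOfRecord₁₀ F N θ.toStage9Params p) (k + 1) s')) V = 0 →
      rterm (repr218OfRecord F N θ.ν θ.τ9.M (slotsTOfRecord F N θ.ν θ.τ9 (EOfRecord₁₀ F N θ.toStage9Params)
        (wOfRecord₉ F N θ.toStage9Params) θ.ppSel) p (gOfRecord₁₀ F N θ.toStage9Params p) (k + 1)) s' V = 0 at H
  rw [hsel] at H
  exact H

/-- **AT THE STAGE-12 RECORD, ON A FIXED POINT `s′` OF `θ.ppSel p g (k+1)` ONTO WHICH ONLY 𝐓-ABSENT SEQUENCES ARE SELECTED, THE POST-𝐑 SLOT OF `ρ_{k+1}` IS THE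
PRE-𝐑 SLOT OF `𝐓ρ_k` ON THE `χ_{k+1}(s′)`-SUPPORT** — the selector-of-record case (director-ym LINE №114 (α): range = present sequences; an absent sequence —
zero 𝐓-slot — selected onto `s′` contributes the ratio `∫⌈0 ∕ ∫⌈t_{s′} = 0`), under `Provisos₁₂.base.rstep`. [cite: Balaban1989LargeFieldI, (0.3) p.176, p.177 (i)–(ii); Balaban1988Convergent, (3.24)–(3.25) p.270] -/
theorem slotsOfRecord₁₂_succ_eq_slotsT_of_fix_of_absent (h : θ.Provisos₁₂ F N) (k : ℕ) (hk : k < p.K)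
    (s' : SeqOfRecord F θ.ν θ.τ9.M (gOfRecord₁₀ F N θ.toStage9Params p) p.K (k + 1))
    (hfix : θ.ppSel p (gOfRecord₁₀ F N θ.toStage9Params p) (k + 1) s' = s')
    (habs : ∀ a, θ.ppSel p (gOfRecord₁₀ F N θ.toStage9Params p) (k + 1) a = s' → a ≠ s' →
      slotsTOfRecord F N θ.ν θ.τ9 (EOfRecord₁₀ F N θ.toStage9Params) (wOfRecord₉ F N θ.toStage9Params) θ.ppSel p
        (gOfRecord₁₀ F N θ.toStage9Params p) (k + 1) a = 0)
    (V : GaugeField (F.P p.K) (k + 1) (SU N))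
    (hχ : chiSeqOfRecord F N θ.ν θ.τ9.M (gOfRecord₁₀ F N θ.toStage9Params p) p.K (k + 1) s' V ≠ 0) :
    slotsOfRecord F N θ.ν θ.τ9 (EOfRecord₁₀ F N θ.toStage9Params) (wOfRecord₉ F N θ.toStage9Params) θ.ppSel p
        (gOfRecord₁₀ F N θ.toStage9Params p) (k + 1) s' V
      = slotsTOfRecord F N θ.ν θ.τ9 (EOfRecord₁₀ F N θ.toStage9Params) (wOfRecord₉ F N θ.toStage9Params) θ.ppSel p
          (gOfRecord₁₀ F N θ.toStage9Params p) (k + 1) s' V := by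
  rw [slotsOfRecord_succ]
  refine rstepSlotOfRecord_of_fix_of_absent θ.ν θ.τ9 θ.ppSel p _ (k + 1) _ s' hfix habs V ?_ hχ
  have H := (h.base.rstep p k hk).2.2.2 s' V
  change B15.BasicStep.fibreIntegral (fibOfSeq F θ.ν θ.τ9 p (gOfRecord₁₀ F N θ.toStage9Params p) (k + 1) s')
      (rterm (repr218OfRecord F N θ.ν θ.τ9.M (slotsTOfRecord F N θ.ν θ.τ9 (EOfRecord₁₀ F N θ.toStage9Params)
        (wOfRecord₉ F N θ.toStage9Params) θ.ppSel) p (gOfRecord₁₀ F N θ.toStage9Params p) (k + 1))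
        (θ.ppSel p (gOfRecord₁₀ F N θ.toStage9Params p) (k + 1) s')) V = 0 →
      rterm (repr218OfRecord F N θ.ν θ.τ9.M (slotsTOfRecord F N θ.ν θ.τ9 (EOfRecord₁₀ F N θ.toStage9Params)
        (wOfRecord₉ F N θ.toStage9Params) θ.ppSel) p (gOfRecord₁₀ F N θ.toStage9Params p) (k + 1)) s' V = 0 at H
  rw [hfix] at H
  exact H

/-- **ON A FIXED POINT `s′` OF THE SELECTOR THE POST-𝐑 SLOT OF `ρ_{k+1}` DOMINATES THE PRE-𝐑 SLOT OF `𝐓ρ_k` ON THE `χ_{k+1}(s′)`-SUPPORT, Stage 12**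
(`slotT_{k+1}(s′)(V) ≤ slot_{k+1}(s′)(V)`: the 𝐑-factor of a present sequence is `≥ 1` on the support — n13-c's `le_rstepSlotOfRecord_of_sel_self` under
`Provisos₁₂.base.rstep`; p. 176 «the denominators are positive» read on the support).  What [B16] Theorem 1 absorbs at a present sequence has non-negative
logarithm there. [cite: Balaban1989LargeFieldI, (0.3) p.176, Prop. 1 (1.2) p.177; Balaban1989LargeFieldII, Thm 1 p.355] -/
theorem slotsT_le_slotsOfRecord₁₂_succ_of_sel_self (h : θ.Provisos₁₂ F N) (k : ℕ) (hk : k < p.K)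
    (s' : SeqOfRecord F θ.ν θ.τ9.M (gOfRecord₁₀ F N θ.toStage9Params p) p.K (k + 1))
    (hfix : θ.ppSel p (gOfRecord₁₀ F N θ.toStage9Params p) (k + 1) s' = s') (V : GaugeField (F.P p.K) (k + 1) (SU N))
    (hχ : chiSeqOfRecord F N θ.ν θ.τ9.M (gOfRecord₁₀ F N θ.toStage9Params p) p.K (k + 1) s' V ≠ 0) :
    slotsTOfRecord F N θ.ν θ.τ9 (EOfRecord₁₀ F N θ.toStage9Params) (wOfRecord₉ F N θ.toStage9Params) θ.ppSel p
        (gOfRecord₁₀ F N θ.toStage9Params p) (k + 1) s' V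
      ≤ slotsOfRecord F N θ.ν θ.τ9 (EOfRecord₁₀ F N θ.toStage9Params) (wOfRecord₉ F N θ.toStage9Params) θ.ppSel p
          (gOfRecord₁₀ F N θ.toStage9Params p) (k + 1) s' V := by
  rw [slotsOfRecord_succ]
  have HP := h.base.rstep p k hk
  have H0 := HP.2.1 s' V
  have Hs := HP.2.2.2 s' V
  change 0 ≤ rterm (repr218OfRecord F N θ.ν θ.τ9.M (slotsTOfRecord F N θ.ν θ.τ9 (EOfRecord₁₀ F N θ.toStage9Params)
      (wOfRecord₉ F N θ.toStage9Params) θ.ppSel) p (gOfRecord₁₀ F N θ.toStage9Params p) (k + 1)) s' V at H0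
  change B15.BasicStep.fibreIntegral (fibOfSeq F θ.ν θ.τ9 p (gOfRecord₁₀ F N θ.toStage9Params p) (k + 1) s')
      (rterm (repr218OfRecord F N θ.ν θ.τ9.M (slotsTOfRecord F N θ.ν θ.τ9 (EOfRecord₁₀ F N θ.toStage9Params)
        (wOfRecord₉ F N θ.toStage9Params) θ.ppSel) p (gOfRecord₁₀ F N θ.toStage9Params p) (k + 1))
        (θ.ppSel p (gOfRecord₁₀ F N θ.toStage9Params p) (k + 1) s')) V = 0 →
      rterm (repr218OfRecord F N θ.ν θ.τ9.M (slotsTOfRecord F N θ.ν θ.τ9 (EOfRecord₁₀ F N θ.toStage9Params)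
        (wOfRecord₉ F N θ.toStage9Params) θ.ppSel) p (gOfRecord₁₀ F N θ.toStage9Params p) (k + 1)) s' V = 0 at Hs
  rw [hfix] at Hs
  exact le_rstepSlotOfRecord_of_sel_self θ.ν θ.τ9 θ.ppSel p _ (k + 1) _ s' hfix V H0 Hs hχ

end AtRecordSlots

/-! ## §2  ★ The leaf INHABITED: selectors of record fixing the present sequences (identity selector included) -/

section PresentBranch

variable (θ : Stage12Params F N) (p : B12.RunParams)

/-- **`TLaw₁₂ k → SLaw₁₂ (k+1)` WHEN THE LEVEL-`k+1` SELECTOR IS IDEMPOTENT AND MOVES ONLY 𝐓-ABSENT SEQUENCES**, Stage 12 — the selector-OF-RECORD branch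
(director-ym LINE №114 (α): `Z ↦ Z″` with range the PRESENT sequences, every present sequence fixed, every moved sequence having the zero 𝐓-slot; the identity
selector is the sub-case with nothing moved): the 𝐓-image §2 form of `𝐓ρ_k`'s slots (repaired, dichotomy form) gives the §2 form of `ρ_{k+1}`'s slots at index
`k+1` with the SAME term values and constants — the laws by p. 262 [III] (`HasSect2FormTAEZ.toFormAEZ_succ` under the signs `0 ≤ β` (admissibility), `0 ≤ κ, E₀,
B₀`, `0 ≤ g_{k+1}`, displayed); OFF the range the post-𝐑 slot is absent (§1); ON the range (fixed points) an absent 𝐓-slot stays absent and a present one keeps its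
a.e. identity along `slot_{k+1}(s′) = slotT_{k+1}(s′)` on the `χ_{k+1}(s′)`-support (§1: the selected absent sequences contribute zero ratios).  HONEST SCOPE: on
this branch 𝐑 integrates nothing out of a present term. [cite: Balaban1988Convergent, §2 p.262, Thm 2 p.263, (3.24)–(3.25) p.270; Balaban1989LargeFieldI, (0.3) p.176, p.177 (i)–(ii)] -/
theorem sLaw₁₂_succ_of_tLaw₁₂_of_idem_of_absent (h : θ.Provisos₁₂ F N) (hθ : θ.Admissible F N) (hκ : 0 ≤ θ.s2.lf.κ) (hE₀ : 0 ≤ θ.s2.lf.E₀)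
    (hB₀ : 0 ≤ θ.s2.lf.B₀) (k : ℕ) (hk : k < p.K) (hg : 0 ≤ gOfRecord₁₀ F N θ.toStage9Params p (k + 1))
    (hidem : ∀ a, θ.ppSel p (gOfRecord₁₀ F N θ.toStage9Params p) (k + 1) (θ.ppSel p (gOfRecord₁₀ F N θ.toStage9Params p) (k + 1) a)
      = θ.ppSel p (gOfRecord₁₀ F N θ.toStage9Params p) (k + 1) a)
    (habs : ∀ a, θ.ppSel p (gOfRecord₁₀ F N θ.toStage9Params p) (k + 1) a ≠ a →
      slotsTOfRecord F N θ.ν θ.τ9 (EOfRecord₁₀ F N θ.toStage9Params) (wOfRecord₉ F N θ.toStage9Params) θ.ppSel p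
        (gOfRecord₁₀ F N θ.toStage9Params p) (k + 1) a = 0)
    (hT : TLaw₁₂ F N θ p k) : SLaw₁₂ F N θ p (k + 1) := by
  rw [sLaw₁₂_iff]
  have hA := ((tLaw₁₂_iff F N θ p k).mp hT).toFormAEZ_succ hθ.pos.2.1 hκ hE₀ hB₀ hg
  obtain ⟨t, Ek, hu, hs⟩ := hA
  refine ⟨t, Ek, hu, fun s => ⟨(hs s).1, ?_⟩⟩
  by_cases hmem : s ∈ Set.range (θ.ppSel p (gOfRecord₁₀ F N θ.toStage9Params p) (k + 1))
  · obtain ⟨b, hb⟩ := hmem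
    have hfix : θ.ppSel p (gOfRecord₁₀ F N θ.toStage9Params p) (k + 1) s = s := by rw [← hb]; exact hidem b
    rcases (hs s).2 with h0 | hid
    · exact Or.inl (slotsOfRecord₁₂_succ_eq_zero_of_slotsT_eq_zero F N θ p k s h0)
    · refine Or.inr ?_
      filter_upwards [hid] with V hV hχ
      rw [slotsOfRecord₁₂_succ_eq_slotsT_of_fix_of_absent F N θ p h k hk s hfix
        (fun a ha hne => habs a fun heq => hne (heq.symm.trans ha)) V hχ]
      exact hV hχ
  · exact Or.inl (slotsOfRecord₁₂_succ_eq_zero_of_not_mem_range F N θ p k s hmem)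

/-- **★ THE 𝐑-LEAF OF RECORD AT STAGE 12, INHABITED ON THE SELECTOR-OF-RECORD BRANCH**: if at every level `k < K` the selector `θ.ppSel p g (k+1)` is idempotent
and moves only 𝐓-absent sequences, then — under the (inhabitable) provisos, admissibility, the displayed signs and `0 ≤ g_{k+1}` — `ROpLeaf (VOfRecord₁₂ F N θ p)`:
the junction Prop node N13 produces and node N11 consumes, INHABITED at a V of record with content (no vacuous proviso).  Scope: the branch on which 𝐑 integrates
nothing out of a present term; [B16] Theorem 1's 𝐑-construction is not exercised. [cite: Balaban1988Convergent, p.244, Thm 2 p.263, §2 p.262; Balaban1989LargeFieldI, (0.3) p.176, p.177 (i)–(ii); Balaban1989LargeFieldII, Thm 1 p.355 (what the general case needs)] -/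
theorem rOpLeaf_VOfRecord₁₂_of_idem_of_absent (h : θ.Provisos₁₂ F N) (hθ : θ.Admissible F N) (hκ : 0 ≤ θ.s2.lf.κ) (hE₀ : 0 ≤ θ.s2.lf.E₀)
    (hB₀ : 0 ≤ θ.s2.lf.B₀) (hg : ∀ k, k < p.K → 0 ≤ gOfRecord₁₀ F N θ.toStage9Params p (k + 1))
    (hidem : ∀ k, k < p.K → ∀ a, θ.ppSel p (gOfRecord₁₀ F N θ.toStage9Params p) (k + 1)
      (θ.ppSel p (gOfRecord₁₀ F N θ.toStage9Params p) (k + 1) a) = θ.ppSel p (gOfRecord₁₀ F N θ.toStage9Params p) (k + 1) a)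
    (habs : ∀ k, k < p.K → ∀ a, θ.ppSel p (gOfRecord₁₀ F N θ.toStage9Params p) (k + 1) a ≠ a →
      slotsTOfRecord F N θ.ν θ.τ9 (EOfRecord₁₀ F N θ.toStage9Params) (wOfRecord₉ F N θ.toStage9Params) θ.ppSel p
        (gOfRecord₁₀ F N θ.toStage9Params p) (k + 1) a = 0) :
    ROpLeaf (VOfRecord₁₂ F N θ p) := by
  rw [rOpLeaf_VOfRecord₁₂_iff]
  intro k hk hT
  exact sLaw₁₂_succ_of_tLaw₁₂_of_idem_of_absent F N θ p h hθ hκ hE₀ hB₀ k hk (hg k hk) (hidem k hk) (habs k hk) hT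

/-- The same with `0 ≤ g_{k+1}` DISCHARGED by the coupling window of the run AT THE DATUM OF RECORD (`((datumOfRecord₁₂ θ h).C p).flow.InInterval γ K`:
`0 < g_k ≤ γ`, `k ≤ K` — the clause the (B)-face and N11's interval antecedent carry; `flow_g_datumOfRecord₁₂`). [cite: Balaban1989LargeFieldII, Thm 1 p.355; Balaban1987RG1, (0.17)–(0.20) pp.255–256] -/
theorem rOpLeaf_VOfRecord₁₂_of_idem_of_absent_of_inInterval (h : θ.Provisos₁₂ F N) (hθ : θ.Admissible F N) (hκ : 0 ≤ θ.s2.lf.κ)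
    (hE₀ : 0 ≤ θ.s2.lf.E₀) (hB₀ : 0 ≤ θ.s2.lf.B₀) {γ : ℝ} (hsc : ((datumOfRecord₁₂ F N θ h).C p).flow.InInterval γ p.K)
    (hidem : ∀ k, k < p.K → ∀ a, θ.ppSel p (gOfRecord₁₀ F N θ.toStage9Params p) (k + 1)
      (θ.ppSel p (gOfRecord₁₀ F N θ.toStage9Params p) (k + 1) a) = θ.ppSel p (gOfRecord₁₀ F N θ.toStage9Params p) (k + 1) a)
    (habs : ∀ k, k < p.K → ∀ a, θ.ppSel p (gOfRecord₁₀ F N θ.toStage9Params p) (k + 1) a ≠ a →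
      slotsTOfRecord F N θ.ν θ.τ9 (EOfRecord₁₀ F N θ.toStage9Params) (wOfRecord₉ F N θ.toStage9Params) θ.ppSel p
        (gOfRecord₁₀ F N θ.toStage9Params p) (k + 1) a = 0) :
    ROpLeaf (VOfRecord₁₂ F N θ p) :=
  rOpLeaf_VOfRecord₁₂_of_idem_of_absent F N θ p h hθ hκ hE₀ hB₀
    (fun k hk => by
      have hgk := (hsc (k + 1) hk).1
      rw [flow_g_datumOfRecord₁₂] at hgk
      exact hgk.le) hidem habs

/-- **`TLaw₁₂ k → SLaw₁₂ (k+1)` ON THE IDENTITY-SELECTOR BRANCH**, Stage 12 (the Stage-12 twin of n13-c's inhabitation theorem, now under inhabitable provisos): the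
sub-case of `sLaw₁₂_succ_of_tLaw₁₂_of_idem_of_absent` in which nothing is moved. [cite: Balaban1988Convergent, §2 p.262, Thm 2 p.263; Balaban1989LargeFieldI, (0.3) p.176] -/
theorem sLaw₁₂_succ_of_tLaw₁₂_of_forall_sel_eq (h : θ.Provisos₁₂ F N) (hθ : θ.Admissible F N) (hκ : 0 ≤ θ.s2.lf.κ) (hE₀ : 0 ≤ θ.s2.lf.E₀)
    (hB₀ : 0 ≤ θ.s2.lf.B₀) (k : ℕ) (hk : k < p.K) (hg : 0 ≤ gOfRecord₁₀ F N θ.toStage9Params p (k + 1))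
    (hsel : ∀ a, θ.ppSel p (gOfRecord₁₀ F N θ.toStage9Params p) (k + 1) a = a) (hT : TLaw₁₂ F N θ p k) :
    SLaw₁₂ F N θ p (k + 1) :=
  sLaw₁₂_succ_of_tLaw₁₂_of_idem_of_absent F N θ p h hθ hκ hE₀ hB₀ k hk hg (fun a => by rw [hsel, hsel])
    (fun a hne => absurd (hsel a) hne) hT

/-- **★ THE IDENTITY-SELECTOR BRANCH INHABITS THE 𝐑-LEAF OF RECORD AT STAGE 12** (`θ.ppSel p g (k+1) = id`, `k < K`): under the provisos, admissibility, the
displayed signs and `0 ≤ g_{k+1}`, `ROpLeaf (VOfRecord₁₂ F N θ p)` — the «𝐑 = 1» branch (every carrier of record before director-ym LINE №114 (α); TRUE but OFF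
the re-pinned K0′ witness after it, whose branch is `rOpLeaf_VOfRecord₁₂_of_idem_of_absent` or §3). [cite: Balaban1988Convergent, p.244, Thm 2 p.263; Balaban1989LargeFieldI, (0.3) p.176; Balaban1989LargeFieldII, Thm 1 p.355 (not exercised on this branch)] -/
theorem rOpLeaf_VOfRecord₁₂_of_forall_sel_eq (h : θ.Provisos₁₂ F N) (hθ : θ.Admissible F N) (hκ : 0 ≤ θ.s2.lf.κ) (hE₀ : 0 ≤ θ.s2.lf.E₀)
    (hB₀ : 0 ≤ θ.s2.lf.B₀) (hg : ∀ k, k < p.K → 0 ≤ gOfRecord₁₀ F N θ.toStage9Params p (k + 1))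
    (hsel : ∀ k, k < p.K → ∀ a, θ.ppSel p (gOfRecord₁₀ F N θ.toStage9Params p) (k + 1) a = a) :
    ROpLeaf (VOfRecord₁₂ F N θ p) := by
  rw [rOpLeaf_VOfRecord₁₂_iff]
  intro k hk hT
  exact sLaw₁₂_succ_of_tLaw₁₂_of_forall_sel_eq F N θ p h hθ hκ hE₀ hB₀ k hk (hg k hk) (hsel k hk) hT

/-- The same with `0 ≤ g_{k+1}` DISCHARGED by the coupling window of the run at the datum of record. [cite: Balaban1989LargeFieldII, Thm 1 p.355; Balaban1987RG1, (0.17)–(0.20) pp.255–256] -/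
theorem rOpLeaf_VOfRecord₁₂_of_forall_sel_eq_of_inInterval (h : θ.Provisos₁₂ F N) (hθ : θ.Admissible F N) (hκ : 0 ≤ θ.s2.lf.κ) (hE₀ : 0 ≤ θ.s2.lf.E₀)
    (hB₀ : 0 ≤ θ.s2.lf.B₀) {γ : ℝ} (hsc : ((datumOfRecord₁₂ F N θ h).C p).flow.InInterval γ p.K)
    (hsel : ∀ k, k < p.K → ∀ a, θ.ppSel p (gOfRecord₁₀ F N θ.toStage9Params p) (k + 1) a = a) :
    ROpLeaf (VOfRecord₁₂ F N θ p) :=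
  rOpLeaf_VOfRecord₁₂_of_forall_sel_eq F N θ p h hθ hκ hE₀ hB₀
    (fun k hk => by
      have hgk := (hsc (k + 1) hk).1
      rw [flow_g_datumOfRecord₁₂] at hgk
      exact hgk.le) hsel

/-- **World form for the consumers of the leaf** (N11 ∕ N13 ∕ N24 knits read `(leavesP w P).rOperation` at a world bound over the Stage-12 view, `w.up P = upOfRecord₅C
F N (θ.toStage5₁₂ F N) P`): on the selector-of-record branch the run's `rOperation` leaf HOLDS (this seat's `rOperation_iff_rOpLeaf₁₂` ∘ §2).
[cite: Balaban1988Convergent, p.244; Balaban1989LargeFieldII, Thm 1 p.355 (bookkeeping)] -/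
theorem rOperation_leavesP_of_idem_of_absent₁₂ (w : WorldP) (hup : w.up p = upOfRecord₅C F N (θ.toStage5₁₂ F N) p) (h : θ.Provisos₁₂ F N)
    (hθ : θ.Admissible F N) (hκ : 0 ≤ θ.s2.lf.κ) (hE₀ : 0 ≤ θ.s2.lf.E₀) (hB₀ : 0 ≤ θ.s2.lf.B₀)
    (hg : ∀ k, k < p.K → 0 ≤ gOfRecord₁₀ F N θ.toStage9Params p (k + 1))
    (hidem : ∀ k, k < p.K → ∀ a, θ.ppSel p (gOfRecord₁₀ F N θ.toStage9Params p) (k + 1)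
      (θ.ppSel p (gOfRecord₁₀ F N θ.toStage9Params p) (k + 1) a) = θ.ppSel p (gOfRecord₁₀ F N θ.toStage9Params p) (k + 1) a)
    (habs : ∀ k, k < p.K → ∀ a, θ.ppSel p (gOfRecord₁₀ F N θ.toStage9Params p) (k + 1) a ≠ a →
      slotsTOfRecord F N θ.ν θ.τ9 (EOfRecord₁₀ F N θ.toStage9Params) (wOfRecord₉ F N θ.toStage9Params) θ.ppSel p
        (gOfRecord₁₀ F N θ.toStage9Params p) (k + 1) a = 0) :
    (leavesP w p).rOperation :=
  (rOperation_iff_rOpLeaf₁₂ F N θ w p hup).2 (rOpLeaf_VOfRecord₁₂_of_idem_of_absent F N θ p h hθ hκ hE₀ hB₀ hg hidem habs)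

/-- World form, identity-selector branch. [cite: Balaban1988Convergent, p.244; Balaban1989LargeFieldII, Thm 1 p.355 (bookkeeping)] -/
theorem rOperation_leavesP_of_forall_sel_eq₁₂ (w : WorldP) (hup : w.up p = upOfRecord₅C F N (θ.toStage5₁₂ F N) p) (h : θ.Provisos₁₂ F N)
    (hθ : θ.Admissible F N) (hκ : 0 ≤ θ.s2.lf.κ) (hE₀ : 0 ≤ θ.s2.lf.E₀) (hB₀ : 0 ≤ θ.s2.lf.B₀)
    (hg : ∀ k, k < p.K → 0 ≤ gOfRecord₁₀ F N θ.toStage9Params p (k + 1))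
    (hsel : ∀ k, k < p.K → ∀ a, θ.ppSel p (gOfRecord₁₀ F N θ.toStage9Params p) (k + 1) a = a) :
    (leavesP w p).rOperation :=
  (rOperation_iff_rOpLeaf₁₂ F N θ w p hup).2 (rOpLeaf_VOfRecord₁₂_of_forall_sel_eq F N θ p h hθ hκ hE₀ hB₀ hg hsel)

end PresentBranch

/-! ## §3  The general-selector socket PER PRESENT SEQUENCE ([IV] Prop. 1 + [B16] (1.100)–(1.101) at the objects of record; off-range discharged by §1) -/

section Socket

variable (θ : Stage12Params F N) (p : B12.RunParams)

/-- **`TLaw₁₂ k → SLaw₁₂ (k+1)` FROM THE ABSORPTION OF THE 𝐑-FACTOR AT THE PRESENT SEQUENCES** (general selector): if the witnesses `t, E_k` of the 𝐓-image form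
of `𝐓ρ_k`'s slots (laws `LawsT … k` and, per sequence, «absent or the §2 identity a.e. on the support») can be RE-PRESENTED by term values `t′, E′` — universal in
𝐄, obeying the inductive assumptions `LawsRT … (k+1)` at EVERY sequence — such that AT EVERY PRESENT SEQUENCE `s′ ∈ range (θ.ppSel p g (k+1))` the post-𝐑 slot
`slot_{k+1}(s′)` is absent or equals `𝐓_{k+1}(s′) e^{A(t′ s′)}` a.e. on the `χ_{k+1}(s′)`-support (the 𝐑-factor absorbed into new terms), then `SLaw₁₂ θ p (k+1)` —
the OFF-RANGE sequences being absent from `ρ_{k+1}` by §1.  The displayed hypothesis is [IV] Prop. 1 (1.1)–(1.2) with [B16] (1.100)–(1.101) READ AT THE STAGE-12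
OBJECTS OF RECORD (not in the tree at the record; NOT asserted).
[cite: Balaban1989LargeFieldI, Prop. 1 (1.1)–(1.2) p.177, (0.3) p.176; Balaban1989LargeFieldII, Thm 1 p.355, (1.100)–(1.101) pp.390–391; Balaban1988Convergent, Thm 2 p.263] -/
theorem sLaw₁₂_succ_of_tLaw₁₂_of_absorbPresent (k : ℕ) (hT : TLaw₁₂ F N θ p k)
    (habs : ∀ (t : SeqOfRecord F θ.ν θ.τ9.M (gOfRecord₁₀ F N θ.toStage9Params p) p.K (k + 1) → Sect2.TermValues (F.P p.K) (MatA N) (FluctV N) θ.τ9.M)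
      (Ek : SeqOfRecord F θ.ν θ.τ9.M (gOfRecord₁₀ F N θ.toStage9Params p) p.K (k + 1) → ℝ), Sect2.UniversalE t →
      (∀ s, Sect2.LawsT (sect2TowerOfRecord F N (FluctV N) p.K (settingOfRecord₁₂ F N θ p) (θ.Rz p.K) s (t s)) (settingOfRecord₁₂ F N θ p).lf
          (settingOfRecord₁₂ F N θ p).βc k ∧
        (slotsTOfRecord F N θ.ν θ.τ9 (EOfRecord₁₀ F N θ.toStage9Params) (wOfRecord₉ F N θ.toStage9Params) θ.ppSel p
            (gOfRecord₁₀ F N θ.toStage9Params p) (k + 1) s = 0 ∨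
          ∀ᵐ V ∂(fieldMeasure (F.P p.K) (k + 1) (SU N)), chiSeqOfRecord F N θ.ν θ.τ9.M (gOfRecord₁₀ F N θ.toStage9Params p) p.K (k + 1) s V ≠ 0 →
            slotsTOfRecord F N θ.ν θ.τ9 (EOfRecord₁₀ F N θ.toStage9Params) (wOfRecord₉ F N θ.toStage9Params) θ.ppSel p
                (gOfRecord₁₀ F N θ.toStage9Params p) (k + 1) s V
              = sect2Slot F N (FluctV N) p.K (settingOfRecord₁₂ F N θ p) (θ.Rz p.K) (WtOfRecord₁₂ F N θ p) s (t s) (Ek s)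
                  (UbgOfRecord₁₂ F N θ p (k + 1) s) V)) →
      ∃ (t' : SeqOfRecord F θ.ν θ.τ9.M (gOfRecord₁₀ F N θ.toStage9Params p) p.K (k + 1) → Sect2.TermValues (F.P p.K) (MatA N) (FluctV N) θ.τ9.M)
        (Ek' : SeqOfRecord F θ.ν θ.τ9.M (gOfRecord₁₀ F N θ.toStage9Params p) p.K (k + 1) → ℝ), Sect2.UniversalE t' ∧
        (∀ s, Sect2.LawsRT (sect2TowerOfRecord F N (FluctV N) p.K (settingOfRecord₁₂ F N θ p) (θ.Rz p.K) s (t' s)) (settingOfRecord₁₂ F N θ p).lf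
            (k + 1)) ∧
        ∀ s, s ∈ Set.range (θ.ppSel p (gOfRecord₁₀ F N θ.toStage9Params p) (k + 1)) →
          (slotsOfRecord F N θ.ν θ.τ9 (EOfRecord₁₀ F N θ.toStage9Params) (wOfRecord₉ F N θ.toStage9Params) θ.ppSel p
              (gOfRecord₁₀ F N θ.toStage9Params p) (k + 1) s = 0 ∨
            ∀ᵐ V ∂(fieldMeasure (F.P p.K) (k + 1) (SU N)), chiSeqOfRecord F N θ.ν θ.τ9.M (gOfRecord₁₀ F N θ.toStage9Params p) p.K (k + 1) s V ≠ 0 →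
              slotsOfRecord F N θ.ν θ.τ9 (EOfRecord₁₀ F N θ.toStage9Params) (wOfRecord₉ F N θ.toStage9Params) θ.ppSel p
                  (gOfRecord₁₀ F N θ.toStage9Params p) (k + 1) s V
                = sect2Slot F N (FluctV N) p.K (settingOfRecord₁₂ F N θ p) (θ.Rz p.K) (WtOfRecord₁₂ F N θ p) s (t' s) (Ek' s)
                    (UbgOfRecord₁₂ F N θ p (k + 1) s) V)) :
    SLaw₁₂ F N θ p (k + 1) := by
  rw [sLaw₁₂_iff]
  obtain ⟨t, Ek, hu, hs⟩ := (tLaw₁₂_iff F N θ p k).mp hT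
  obtain ⟨t', Ek', hu', hl', hs'⟩ := habs t Ek hu hs
  refine ⟨t', Ek', hu', fun s => ⟨hl' s, ?_⟩⟩
  by_cases hmem : s ∈ Set.range (θ.ppSel p (gOfRecord₁₀ F N θ.toStage9Params p) (k + 1))
  · exact hs' s hmem
  · exact Or.inl (slotsOfRecord₁₂_succ_eq_zero_of_not_mem_range F N θ p k s hmem)

/-- **THE GENERAL-SELECTOR SOCKET FOR THE STAGE-12 LEAF**: the present-sequence absorption hypothesis of `sLaw₁₂_succ_of_tLaw₁₂_of_absorbPresent` at every level
`k < K` gives `ROpLeaf (VOfRecord₁₂ F N θ p)` — the DISCHARGE-SHAPED statement of the 𝐑-half of N13 at Stage 12: its one displayed hypothesis is [B16] Theorem 1's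
𝐑-construction read at the objects of record, asked ONLY where print's 𝐑 acts (NOT asserted; the first estimate of the 𝐑-half missing from the tree at the record).
[cite: Balaban1989LargeFieldII, Thm 1 p.355, (1.100)–(1.101) pp.390–391; Balaban1989LargeFieldI, Prop. 1 (1.1)–(1.2) p.177; Balaban1988Convergent, p.244, Thm 2 p.263] -/
theorem rOpLeaf_VOfRecord₁₂_of_absorbPresent
    (habs : ∀ k, k < p.K →
      ∀ (t : SeqOfRecord F θ.ν θ.τ9.M (gOfRecord₁₀ F N θ.toStage9Params p) p.K (k + 1) → Sect2.TermValues (F.P p.K) (MatA N) (FluctV N) θ.τ9.M)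
      (Ek : SeqOfRecord F θ.ν θ.τ9.M (gOfRecord₁₀ F N θ.toStage9Params p) p.K (k + 1) → ℝ), Sect2.UniversalE t →
      (∀ s, Sect2.LawsT (sect2TowerOfRecord F N (FluctV N) p.K (settingOfRecord₁₂ F N θ p) (θ.Rz p.K) s (t s)) (settingOfRecord₁₂ F N θ p).lf
          (settingOfRecord₁₂ F N θ p).βc k ∧
        (slotsTOfRecord F N θ.ν θ.τ9 (EOfRecord₁₀ F N θ.toStage9Params) (wOfRecord₉ F N θ.toStage9Params) θ.ppSel p
            (gOfRecord₁₀ F N θ.toStage9Params p) (k + 1) s = 0 ∨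
          ∀ᵐ V ∂(fieldMeasure (F.P p.K) (k + 1) (SU N)), chiSeqOfRecord F N θ.ν θ.τ9.M (gOfRecord₁₀ F N θ.toStage9Params p) p.K (k + 1) s V ≠ 0 →
            slotsTOfRecord F N θ.ν θ.τ9 (EOfRecord₁₀ F N θ.toStage9Params) (wOfRecord₉ F N θ.toStage9Params) θ.ppSel p
                (gOfRecord₁₀ F N θ.toStage9Params p) (k + 1) s V
              = sect2Slot F N (FluctV N) p.K (settingOfRecord₁₂ F N θ p) (θ.Rz p.K) (WtOfRecord₁₂ F N θ p) s (t s) (Ek s)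
                  (UbgOfRecord₁₂ F N θ p (k + 1) s) V)) →
      ∃ (t' : SeqOfRecord F θ.ν θ.τ9.M (gOfRecord₁₀ F N θ.toStage9Params p) p.K (k + 1) → Sect2.TermValues (F.P p.K) (MatA N) (FluctV N) θ.τ9.M)
        (Ek' : SeqOfRecord F θ.ν θ.τ9.M (gOfRecord₁₀ F N θ.toStage9Params p) p.K (k + 1) → ℝ), Sect2.UniversalE t' ∧
        (∀ s, Sect2.LawsRT (sect2TowerOfRecord F N (FluctV N) p.K (settingOfRecord₁₂ F N θ p) (θ.Rz p.K) s (t' s)) (settingOfRecord₁₂ F N θ p).lf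
            (k + 1)) ∧
        ∀ s, s ∈ Set.range (θ.ppSel p (gOfRecord₁₀ F N θ.toStage9Params p) (k + 1)) →
          (slotsOfRecord F N θ.ν θ.τ9 (EOfRecord₁₀ F N θ.toStage9Params) (wOfRecord₉ F N θ.toStage9Params) θ.ppSel p
              (gOfRecord₁₀ F N θ.toStage9Params p) (k + 1) s = 0 ∨
            ∀ᵐ V ∂(fieldMeasure (F.P p.K) (k + 1) (SU N)), chiSeqOfRecord F N θ.ν θ.τ9.M (gOfRecord₁₀ F N θ.toStage9Params p) p.K (k + 1) s V ≠ 0 →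
              slotsOfRecord F N θ.ν θ.τ9 (EOfRecord₁₀ F N θ.toStage9Params) (wOfRecord₉ F N θ.toStage9Params) θ.ppSel p
                  (gOfRecord₁₀ F N θ.toStage9Params p) (k + 1) s V
                = sect2Slot F N (FluctV N) p.K (settingOfRecord₁₂ F N θ p) (θ.Rz p.K) (WtOfRecord₁₂ F N θ p) s (t' s) (Ek' s)
                    (UbgOfRecord₁₂ F N θ p (k + 1) s) V)) :
    ROpLeaf (VOfRecord₁₂ F N θ p) := by
  rw [rOpLeaf_VOfRecord₁₂_iff]
  intro k hk hT
  exact sLaw₁₂_succ_of_tLaw₁₂_of_absorbPresent F N θ p k hT (habs k hk)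

end Socket

/-! ## §4  ★ THE N11∕N13 JUNCTION COMPOSED BY NAME: Theorem 1 [III], the node, and the (B)-face's first conjunct from the Theorem of p. 245 ALONE on the §2 branch -/

section Junction

variable (θ : Stage12Params F N) (p : B12.RunParams)

/-- **★ THEOREM 1 [III] AT THE STAGE-12 OBJECTS OF RECORD FROM N11's ONE SLOT (S1ᵀ) ALONE, ON THE SELECTOR-OF-RECORD BRANCH** ([Balaban1988Convergent] Thm 1
p. 262; its printed proof = START + THE THEOREM OF p. 245 + THE ASSUMED 𝐑 along (0.2)): at a `θ` whose selectors `θ.ppSel p g (k+1)`, `k < K`, are idempotent and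
move only 𝐓-absent sequences, the p. 244 assumption `B14.RAssumedP244` at the 𝐑-carriers of record — node N13's product — is §2's THEOREM, so this seat's relative
closer `B14NodeKnitRecord12R.sLaw₁₂_all_of_rAssumedP244` (start = node00-def-T's theorem `sLaw₁₂_zero`) needs ONLY `hT` — the Theorem of p. 245 at the objects of
record, `∀ k < K, SLaw₁₂ θ p k → TLaw₁₂ θ p k` — and the displayed signs: EVERY `ρ_k` of record, `k ≤ K`, has the repaired §2 [III] form of record.  Honest scope
in the header: on this branch (S1ᵀ) carries the whole analytic burden. [cite: Balaban1988Convergent, Thm 1 p.262; Theorem p.245; p.244; Balaban1989LargeFieldI, (0.3) p.176, p.177 (i)–(ii)] -/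
theorem sLaw₁₂_all_of_thmP245_of_idem_of_absent (h : θ.Provisos₁₂ F N) (hθ : θ.Admissible F N) (hκ : 0 ≤ θ.s2.lf.κ) (hE₀ : 0 ≤ θ.s2.lf.E₀)
    (hB₀ : 0 ≤ θ.s2.lf.B₀) (hg : ∀ k, k < p.K → 0 ≤ gOfRecord₁₀ F N θ.toStage9Params p (k + 1))
    (hidem : ∀ k, k < p.K → ∀ a, θ.ppSel p (gOfRecord₁₀ F N θ.toStage9Params p) (k + 1)
      (θ.ppSel p (gOfRecord₁₀ F N θ.toStage9Params p) (k + 1) a) = θ.ppSel p (gOfRecord₁₀ F N θ.toStage9Params p) (k + 1) a)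
    (habs : ∀ k, k < p.K → ∀ a, θ.ppSel p (gOfRecord₁₀ F N θ.toStage9Params p) (k + 1) a ≠ a →
      slotsTOfRecord F N θ.ν θ.τ9 (EOfRecord₁₀ F N θ.toStage9Params) (wOfRecord₉ F N θ.toStage9Params) θ.ppSel p
        (gOfRecord₁₀ F N θ.toStage9Params p) (k + 1) a = 0)
    (hT : ∀ k, k < p.K → SLaw₁₂ F N θ p k → TLaw₁₂ F N θ p k) :
    ∀ k, k ≤ p.K → SLaw₁₂ F N θ p k :=
  sLaw₁₂_all_of_rAssumedP244 F N θ p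
    ((rOpLeaf₁₂_iff_rAssumedP244 F N θ p).1 (rOpLeaf_VOfRecord₁₂_of_idem_of_absent F N θ p h hθ hκ hE₀ hB₀ hg hidem habs)) hT

/-- **THEOREM 1 [III] AT THE STAGE-12 OBJECTS OF RECORD FROM (S1ᵀ) ALONE, identity-selector branch** (the sub-case with nothing moved).
[cite: Balaban1988Convergent, Thm 1 p.262; Theorem p.245; p.244; Balaban1989LargeFieldI, (0.3) p.176] -/
theorem sLaw₁₂_all_of_thmP245_of_forall_sel_eq (h : θ.Provisos₁₂ F N) (hθ : θ.Admissible F N) (hκ : 0 ≤ θ.s2.lf.κ) (hE₀ : 0 ≤ θ.s2.lf.E₀)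
    (hB₀ : 0 ≤ θ.s2.lf.B₀) (hg : ∀ k, k < p.K → 0 ≤ gOfRecord₁₀ F N θ.toStage9Params p (k + 1))
    (hsel : ∀ k, k < p.K → ∀ a, θ.ppSel p (gOfRecord₁₀ F N θ.toStage9Params p) (k + 1) a = a)
    (hT : ∀ k, k < p.K → SLaw₁₂ F N θ p k → TLaw₁₂ F N θ p k) :
    ∀ k, k ≤ p.K → SLaw₁₂ F N θ p k :=
  sLaw₁₂_all_of_rAssumedP244 F N θ p
    ((rOpLeaf₁₂_iff_rAssumedP244 F N θ p).1 (rOpLeaf_VOfRecord₁₂_of_forall_sel_eq F N θ p h hθ hκ hE₀ hB₀ hg hsel)) hT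

variable (w : WorldP) (h : θ.Provisos₁₂ F N)

/-- **Theorem 1's conclusion `densitiesDescribed` AT A STAGE-12 WORLD FROM (S1ᵀ) ALONE, selector-of-record branch**: at `w.C = (datumOfRecord₁₂ F N θ h).C`, the
Theorem of p. 245 at the objects of record (+ signs, non-negative history) gives `(leavesP w p).densitiesDescribed` — this seat's
`densitiesDescribed_at_record₁₂_of_rOpLeaf` with the leaf SUPPLIED by §2 instead of hypothesised. [cite: Balaban1988Convergent, Thm 1 p.262; Theorem p.245; p.244] -/
theorem densitiesDescribed_at_record₁₂_of_idem_of_absent (hC : w.C = (datumOfRecord₁₂ F N θ h).C) (hθ : θ.Admissible F N) (hκ : 0 ≤ θ.s2.lf.κ)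
    (hE₀ : 0 ≤ θ.s2.lf.E₀) (hB₀ : 0 ≤ θ.s2.lf.B₀) (hg : ∀ k, k < p.K → 0 ≤ gOfRecord₁₀ F N θ.toStage9Params p (k + 1))
    (hidem : ∀ k, k < p.K → ∀ a, θ.ppSel p (gOfRecord₁₀ F N θ.toStage9Params p) (k + 1)
      (θ.ppSel p (gOfRecord₁₀ F N θ.toStage9Params p) (k + 1) a) = θ.ppSel p (gOfRecord₁₀ F N θ.toStage9Params p) (k + 1) a)
    (habs : ∀ k, k < p.K → ∀ a, θ.ppSel p (gOfRecord₁₀ F N θ.toStage9Params p) (k + 1) a ≠ a →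
      slotsTOfRecord F N θ.ν θ.τ9 (EOfRecord₁₀ F N θ.toStage9Params) (wOfRecord₉ F N θ.toStage9Params) θ.ppSel p
        (gOfRecord₁₀ F N θ.toStage9Params p) (k + 1) a = 0)
    (hT : ∀ k, k < p.K → SLaw₁₂ F N θ p k → TLaw₁₂ F N θ p k) :
    (leavesP w p).densitiesDescribed :=
  densitiesDescribed_at_record₁₂_of_rOpLeaf F N θ p w h hC (rOpLeaf_VOfRecord₁₂_of_idem_of_absent F N θ p h hθ hκ hE₀ hB₀ hg hidem habs) hT

/-- **N11 · `Dag.B14_main (leavesP w P)` AT A STAGE-12 WORLD ON THE SELECTOR-OF-RECORD BRANCH — ONE DISPLAYED SLOT, NO 𝐑-READING HYPOTHESIS**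
([Balaban1988Convergent] Thm 1 p. 262 with the Theorem of p. 245 at NODE 00's Stage-12 objects of record).  Pin `hC`: the world is bound to the datum of record.
Slot (S1ᵀ) `hT`, displayed and printed: the Theorem of p. 245 at the objects of record GIVEN the node's in-edges `b7 … b11`, the interval hypothesis, the small-field
inductive assumptions and the flow control (2.6).  The START is node00-def-T's theorem `sLaw₁₂_zero`; the (𝐑) step is §2's THEOREM on this branch — the sign
`0 ≤ g_{k+1}` it needs is READ FROM THE NODE'S OWN INTERVAL ANTECEDENT `smallCouplings` (`0 < g_k ≤ γ`, `k ≤ K`, at `w.C = (datumOfRecord₁₂ …).C`); the node's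
`rOperation` antecedent is REDUNDANT here (received, not used — the honest mark of a branch on which 𝐑 integrates nothing out of a present term).  Count-neutral
slot landing. [cite: Balaban1988Convergent, Thm 1 p.262; Theorem p.245; p.244; (2.6) p.255] -/
theorem b14_main_at_record₁₂_of_idem_of_absent (hC : w.C = (datumOfRecord₁₂ F N θ h).C) (hθ : θ.Admissible F N) (hκ : 0 ≤ θ.s2.lf.κ)
    (hE₀ : 0 ≤ θ.s2.lf.E₀) (hB₀ : 0 ≤ θ.s2.lf.B₀)
    (hidem : ∀ k, k < p.K → ∀ a, θ.ppSel p (gOfRecord₁₀ F N θ.toStage9Params p) (k + 1)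
      (θ.ppSel p (gOfRecord₁₀ F N θ.toStage9Params p) (k + 1) a) = θ.ppSel p (gOfRecord₁₀ F N θ.toStage9Params p) (k + 1) a)
    (habs : ∀ k, k < p.K → ∀ a, θ.ppSel p (gOfRecord₁₀ F N θ.toStage9Params p) (k + 1) a ≠ a →
      slotsTOfRecord F N θ.ν θ.τ9 (EOfRecord₁₀ F N θ.toStage9Params) (wOfRecord₉ F N θ.toStage9Params) θ.ppSel p
        (gOfRecord₁₀ F N θ.toStage9Params p) (k + 1) a = 0)
    (hT : (leavesP w p).b7 → (leavesP w p).b8 → (leavesP w p).b9 → (leavesP w p).b10 → (leavesP w p).b11 →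
      (leavesP w p).smallCouplings → (leavesP w p).smallFieldInductive → (leavesP w p).flowControl →
        ∀ k, k < p.K → SLaw₁₂ F N θ p k → TLaw₁₂ F N θ p k) :
    Dag.B14_main (leavesP w p) := by
  intro h7 h8 h9 h10 h11 hsf hfc _ hsc
  have hg : ∀ k, k < p.K → 0 ≤ gOfRecord₁₀ F N θ.toStage9Params p (k + 1) := fun k hk => by
    have hgk : 0 < (w.C p).flow.g (k + 1) := (hsc (k + 1) hk).1
    rw [hC, flow_g_datumOfRecord₁₂] at hgk
    exact hgk.le
  exact densitiesDescribed_at_record₁₂_of_rOpLeaf F N θ p w h hC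
    (rOpLeaf_VOfRecord₁₂_of_idem_of_absent F N θ p h hθ hκ hE₀ hB₀ hg hidem habs) (hT h7 h8 h9 h10 h11 hsc (hsf hsc) (hfc hsc))

/-- **N11 · `Dag.B14_main (leavesP w P)` AT A STAGE-12 WORLD, identity-selector branch** (the sub-case with nothing moved; no 𝐑-reading hypothesis).
[cite: Balaban1988Convergent, Thm 1 p.262; Theorem p.245; p.244; (2.6) p.255] -/
theorem b14_main_at_record₁₂_of_forall_sel_eq (hC : w.C = (datumOfRecord₁₂ F N θ h).C) (hθ : θ.Admissible F N) (hκ : 0 ≤ θ.s2.lf.κ)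
    (hE₀ : 0 ≤ θ.s2.lf.E₀) (hB₀ : 0 ≤ θ.s2.lf.B₀)
    (hsel : ∀ k, k < p.K → ∀ a, θ.ppSel p (gOfRecord₁₀ F N θ.toStage9Params p) (k + 1) a = a)
    (hT : (leavesP w p).b7 → (leavesP w p).b8 → (leavesP w p).b9 → (leavesP w p).b10 → (leavesP w p).b11 →
      (leavesP w p).smallCouplings → (leavesP w p).smallFieldInductive → (leavesP w p).flowControl →
        ∀ k, k < p.K → SLaw₁₂ F N θ p k → TLaw₁₂ F N θ p k) :
    Dag.B14_main (leavesP w p) :=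
  b14_main_at_record₁₂_of_idem_of_absent F N θ p w h hC hθ hκ hE₀ hB₀ (fun k hk a => by rw [hsel k hk, hsel k hk])
    (fun k hk a hne => absurd (hsel k hk a) hne) hT

/-- **N11 IN THE BINDER SHAPE OF THE ROUTE's K1′ STUB `stub_nodes12`** (a world `w` with `IsRecordOfRecord₁₂C F N (datumOfRecord₁₂ F N θ h) w` at an EXPLICIT
`(θ, h)` — the shape of `NodesAtSomeRecord12`'s binders): on the selector-of-record branch the N11 conjunct `Dag.B14_main (leavesP w P)` of `DagBinding.Nodes
(leavesP w P)` holds at every run from the slot (S1ᵀ) at `θ`'s objects of record alone (+ the displayed signs) — `construction_eq_of_isRecordOfRecord₁₂C` feeds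
`hC`.  For a K1′ prover choosing `θ` on this branch, N11's share of the stub IS (S1ᵀ). [cite: Balaban1988Convergent, Thm 1 p.262; Theorem p.245; p.244 (bookkeeping at the record)] -/
theorem b14_main_of_isRecordOfRecord₁₂C_datum_of_idem_of_absent (hrec : IsRecordOfRecord₁₂C F N (datumOfRecord₁₂ F N θ h) w)
    (hθ : θ.Admissible F N) (hκ : 0 ≤ θ.s2.lf.κ) (hE₀ : 0 ≤ θ.s2.lf.E₀) (hB₀ : 0 ≤ θ.s2.lf.B₀)
    (hidem : ∀ (P : B12.RunParams) (k : ℕ), k < P.K → ∀ a, θ.ppSel P (gOfRecord₁₀ F N θ.toStage9Params P) (k + 1)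
      (θ.ppSel P (gOfRecord₁₀ F N θ.toStage9Params P) (k + 1) a) = θ.ppSel P (gOfRecord₁₀ F N θ.toStage9Params P) (k + 1) a)
    (habs : ∀ (P : B12.RunParams) (k : ℕ), k < P.K → ∀ a, θ.ppSel P (gOfRecord₁₀ F N θ.toStage9Params P) (k + 1) a ≠ a →
      slotsTOfRecord F N θ.ν θ.τ9 (EOfRecord₁₀ F N θ.toStage9Params) (wOfRecord₉ F N θ.toStage9Params) θ.ppSel P
        (gOfRecord₁₀ F N θ.toStage9Params P) (k + 1) a = 0)
    (hT : ∀ P : B12.RunParams, (leavesP w P).b7 → (leavesP w P).b8 → (leavesP w P).b9 → (leavesP w P).b10 → (leavesP w P).b11 →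
      (leavesP w P).smallCouplings → (leavesP w P).smallFieldInductive → (leavesP w P).flowControl →
        ∀ k, k < P.K → SLaw₁₂ F N θ P k → TLaw₁₂ F N θ P k) (P : B12.RunParams) :
    Dag.B14_main (leavesP w P) :=
  b14_main_at_record₁₂_of_idem_of_absent F N θ P w h (construction_eq_of_isRecordOfRecord₁₂C hrec) hθ hκ hE₀ hB₀ (hidem P) (habs P) (hT P)

/-- **★ THE ROUTE's K1′ (B)-FACE FIRST CONJUNCT `B16.Thm1Printed (datumOfRecord₁₂ F N θ h).C` FROM THE THEOREM OF p. 245 ALONG THE WINDOWED RUNS ALONE, ON THE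
SELECTOR-OF-RECORD BRANCH** ([Balaban1989LargeFieldII] Thm 1 p. 355 = [Balaban1988Convergent] Thm 1 p. 262 as the tree states it over the datum's `Sect2Data`): along
every run whose flow stays in `]0, γ]` (`0 < γ`) and whose positive-level selectors are idempotent and move only 𝐓-absent sequences, N11's slot (S1ᵀ) in law currency
(`hT`) gives Theorem 1 at the datum — this seat's `thm1Printed_datumOfRecord₁₂_of_laws_rAssumedP244` with the p. 244 hypothesis SUPPLIED by §2 (`0 ≤ g` from the
window).  Both remaining hypotheses displayed; nothing of Sects. 1–3 asserted. [cite: Balaban1989LargeFieldII, Thm 1 p.355; Balaban1988Convergent, Thm 1 p.262; Theorem p.245; p.244] -/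
theorem thm1Printed_datumOfRecord₁₂_of_laws_of_idem_of_absent (hθ : θ.Admissible F N) (hκ : 0 ≤ θ.s2.lf.κ) (hE₀ : 0 ≤ θ.s2.lf.E₀)
    (hB₀ : 0 ≤ θ.s2.lf.B₀) {γ : ℝ} (hγ : 0 < γ)
    (hidem : ∀ P : B12.RunParams, ((datumOfRecord₁₂ F N θ h).C P).flow.InInterval γ P.K →
      ∀ k, k < P.K → ∀ a, θ.ppSel P (gOfRecord₁₀ F N θ.toStage9Params P) (k + 1)
        (θ.ppSel P (gOfRecord₁₀ F N θ.toStage9Params P) (k + 1) a) = θ.ppSel P (gOfRecord₁₀ F N θ.toStage9Params P) (k + 1) a)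
    (habs : ∀ P : B12.RunParams, ((datumOfRecord₁₂ F N θ h).C P).flow.InInterval γ P.K →
      ∀ k, k < P.K → ∀ a, θ.ppSel P (gOfRecord₁₀ F N θ.toStage9Params P) (k + 1) a ≠ a →
        slotsTOfRecord F N θ.ν θ.τ9 (EOfRecord₁₀ F N θ.toStage9Params) (wOfRecord₉ F N θ.toStage9Params) θ.ppSel P
          (gOfRecord₁₀ F N θ.toStage9Params P) (k + 1) a = 0)
    (hT : ∀ P : B12.RunParams, ((datumOfRecord₁₂ F N θ h).C P).flow.InInterval γ P.K →
      ∀ k, k < P.K → SLaw₁₂ F N θ P k → TLaw₁₂ F N θ P k) :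
    B16.Thm1Printed (datumOfRecord₁₂ F N θ h).C :=
  thm1Printed_datumOfRecord₁₂_of_laws_rAssumedP244 F N θ h hγ hT
    (fun P hP => (rOpLeaf₁₂_iff_rAssumedP244 F N θ P).1
      (rOpLeaf_VOfRecord₁₂_of_idem_of_absent_of_inInterval F N θ P h hθ hκ hE₀ hB₀ hP (hidem P hP) (habs P hP)))

/-- **The (B)-face's first conjunct from the Theorem of p. 245 along the windowed runs alone, identity-selector branch.**
[cite: Balaban1989LargeFieldII, Thm 1 p.355; Balaban1988Convergent, Thm 1 p.262; Theorem p.245; p.244] -/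
theorem thm1Printed_datumOfRecord₁₂_of_laws_of_forall_sel_eq (hθ : θ.Admissible F N) (hκ : 0 ≤ θ.s2.lf.κ) (hE₀ : 0 ≤ θ.s2.lf.E₀)
    (hB₀ : 0 ≤ θ.s2.lf.B₀) {γ : ℝ} (hγ : 0 < γ)
    (hsel : ∀ P : B12.RunParams, ((datumOfRecord₁₂ F N θ h).C P).flow.InInterval γ P.K →
      ∀ k, k < P.K → ∀ a, θ.ppSel P (gOfRecord₁₀ F N θ.toStage9Params P) (k + 1) a = a)
    (hT : ∀ P : B12.RunParams, ((datumOfRecord₁₂ F N θ h).C P).flow.InInterval γ P.K →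
      ∀ k, k < P.K → SLaw₁₂ F N θ P k → TLaw₁₂ F N θ P k) :
    B16.Thm1Printed (datumOfRecord₁₂ F N θ h).C :=
  thm1Printed_datumOfRecord₁₂_of_laws_rAssumedP244 F N θ h hγ hT
    (fun P hP => (rOpLeaf₁₂_iff_rAssumedP244 F N θ P).1
      (rOpLeaf_VOfRecord₁₂_of_forall_sel_eq_of_inInterval F N θ P h hθ hκ hE₀ hB₀ hP (hsel P hP)))

/-- **`B16.Thm1Printed` AT THE STAGE-12 DATUM FROM [III]'s THEOREM OF p. 245 IN [III]'s OWN NAME, selector-of-record branch** — `B14.ThmP245PrintedI` (sequence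
reading, for any `T`-family agreeing with the tower on the trajectory of each windowed run; this seat's dictionary `thmP245PrintedI_at_record₁₂_iff_laws`): the
director's row «`ThmP245Printed` via `rOperation` from N13's `ROpLeaf`» with N13's leaf a THEOREM of the branch (§2) — so the (B)-face's first conjunct rests on
[III]'s Theorem of p. 245 ALONE.  Dictionary-level in `T` (the cell's `RTOpI` carrier, see `…B14NodeKnitRecord12R`'s framing); load-bearing: `hT`'s law reading.
[cite: Balaban1988Convergent, Theorem p.245, Thm 1 p.262; Balaban1989LargeFieldII, Thm 1 p.355] -/
theorem thm1Printed_datumOfRecord₁₂_of_thmP245I_of_idem_of_absent (hθ : θ.Admissible F N) (hκ : 0 ≤ θ.s2.lf.κ) (hE₀ : 0 ≤ θ.s2.lf.E₀)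
    (hB₀ : 0 ≤ θ.s2.lf.B₀) {γ : ℝ} (hγ : 0 < γ)
    (hidem : ∀ P : B12.RunParams, ((datumOfRecord₁₂ F N θ h).C P).flow.InInterval γ P.K →
      ∀ k, k < P.K → ∀ a, θ.ppSel P (gOfRecord₁₀ F N θ.toStage9Params P) (k + 1)
        (θ.ppSel P (gOfRecord₁₀ F N θ.toStage9Params P) (k + 1) a) = θ.ppSel P (gOfRecord₁₀ F N θ.toStage9Params P) (k + 1) a)
    (habs : ∀ P : B12.RunParams, ((datumOfRecord₁₂ F N θ h).C P).flow.InInterval γ P.K →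
      ∀ k, k < P.K → ∀ a, θ.ppSel P (gOfRecord₁₀ F N θ.toStage9Params P) (k + 1) a ≠ a →
        slotsTOfRecord F N θ.ν θ.τ9 (EOfRecord₁₀ F N θ.toStage9Params) (wOfRecord₉ F N θ.toStage9Params) θ.ppSel P
          (gOfRecord₁₀ F N θ.toStage9Params P) (k + 1) a = 0)
    (T : (P : B12.RunParams) → (k : ℕ) → RTOpI (F.P P.K) k (SU N) (avOfRecord F N P.K k))
    (hTT : ∀ (P : B12.RunParams) (k : ℕ), k < P.K →
      (T P k).T (densOfRecord₁₀ F N θ.toStage9Params P k) = tdensOfRecord₁₀ F N θ.toStage9Params P k)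
    (hT : ∀ P : B12.RunParams, ((datumOfRecord₁₂ F N θ h).C P).flow.InInterval γ P.K →
      B14.ThmP245PrintedI (T P) (densOfRecord₁₀ F N θ.toStage9Params P) (VOfRecord₁₂ F N θ P).S (VOfRecord₁₂ F N θ P).Scorr P.K) :
    B16.Thm1Printed (datumOfRecord₁₂ F N θ h).C :=
  thm1Printed_datumOfRecord₁₂_of_laws_of_idem_of_absent F N θ h hθ hκ hE₀ hB₀ hγ hidem habs
    (fun P hP => (thmP245PrintedI_at_record₁₂_iff_laws F N θ P (T P) (hTT P)).1 (hT P hP))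

/-- **THEOREM 1 [III] AT THE STAGE-12 OBJECTS OF RECORD FROM (S1ᵀ) AND THE PRESENT-SEQUENCE ABSORPTION, general selector**: N11's slot + §3's socket hypothesis
([IV] Prop. 1 + [B16] (1.100)–(1.101) at the objects of record, displayed) ⊢ `∀ k ≤ K, SLaw₁₂ θ p k` — how the two nodes' printed products compose at a record whose
𝐑 is genuine. [cite: Balaban1988Convergent, Thm 1 p.262, Theorem p.245, p.244; Balaban1989LargeFieldII, Thm 1 p.355, (1.100)–(1.101) pp.390–391; Balaban1989LargeFieldI, Prop. 1 p.177] -/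
theorem sLaw₁₂_all_of_thmP245_of_absorbPresent
    (habs : ∀ k, k < p.K →
      ∀ (t : SeqOfRecord F θ.ν θ.τ9.M (gOfRecord₁₀ F N θ.toStage9Params p) p.K (k + 1) → Sect2.TermValues (F.P p.K) (MatA N) (FluctV N) θ.τ9.M)
      (Ek : SeqOfRecord F θ.ν θ.τ9.M (gOfRecord₁₀ F N θ.toStage9Params p) p.K (k + 1) → ℝ), Sect2.UniversalE t →
      (∀ s, Sect2.LawsT (sect2TowerOfRecord F N (FluctV N) p.K (settingOfRecord₁₂ F N θ p) (θ.Rz p.K) s (t s)) (settingOfRecord₁₂ F N θ p).lf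
          (settingOfRecord₁₂ F N θ p).βc k ∧
        (slotsTOfRecord F N θ.ν θ.τ9 (EOfRecord₁₀ F N θ.toStage9Params) (wOfRecord₉ F N θ.toStage9Params) θ.ppSel p
            (gOfRecord₁₀ F N θ.toStage9Params p) (k + 1) s = 0 ∨
          ∀ᵐ V ∂(fieldMeasure (F.P p.K) (k + 1) (SU N)), chiSeqOfRecord F N θ.ν θ.τ9.M (gOfRecord₁₀ F N θ.toStage9Params p) p.K (k + 1) s V ≠ 0 →
            slotsTOfRecord F N θ.ν θ.τ9 (EOfRecord₁₀ F N θ.toStage9Params) (wOfRecord₉ F N θ.toStage9Params) θ.ppSel p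
                (gOfRecord₁₀ F N θ.toStage9Params p) (k + 1) s V
              = sect2Slot F N (FluctV N) p.K (settingOfRecord₁₂ F N θ p) (θ.Rz p.K) (WtOfRecord₁₂ F N θ p) s (t s) (Ek s)
                  (UbgOfRecord₁₂ F N θ p (k + 1) s) V)) →
      ∃ (t' : SeqOfRecord F θ.ν θ.τ9.M (gOfRecord₁₀ F N θ.toStage9Params p) p.K (k + 1) → Sect2.TermValues (F.P p.K) (MatA N) (FluctV N) θ.τ9.M)
        (Ek' : SeqOfRecord F θ.ν θ.τ9.M (gOfRecord₁₀ F N θ.toStage9Params p) p.K (k + 1) → ℝ), Sect2.UniversalE t' ∧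
        (∀ s, Sect2.LawsRT (sect2TowerOfRecord F N (FluctV N) p.K (settingOfRecord₁₂ F N θ p) (θ.Rz p.K) s (t' s)) (settingOfRecord₁₂ F N θ p).lf
            (k + 1)) ∧
        ∀ s, s ∈ Set.range (θ.ppSel p (gOfRecord₁₀ F N θ.toStage9Params p) (k + 1)) →
          (slotsOfRecord F N θ.ν θ.τ9 (EOfRecord₁₀ F N θ.toStage9Params) (wOfRecord₉ F N θ.toStage9Params) θ.ppSel p
              (gOfRecord₁₀ F N θ.toStage9Params p) (k + 1) s = 0 ∨
            ∀ᵐ V ∂(fieldMeasure (F.P p.K) (k + 1) (SU N)), chiSeqOfRecord F N θ.ν θ.τ9.M (gOfRecord₁₀ F N θ.toStage9Params p) p.K (k + 1) s V ≠ 0 →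
              slotsOfRecord F N θ.ν θ.τ9 (EOfRecord₁₀ F N θ.toStage9Params) (wOfRecord₉ F N θ.toStage9Params) θ.ppSel p
                  (gOfRecord₁₀ F N θ.toStage9Params p) (k + 1) s V
                = sect2Slot F N (FluctV N) p.K (settingOfRecord₁₂ F N θ p) (θ.Rz p.K) (WtOfRecord₁₂ F N θ p) s (t' s) (Ek' s)
                    (UbgOfRecord₁₂ F N θ p (k + 1) s) V))
    (hT : ∀ k, k < p.K → SLaw₁₂ F N θ p k → TLaw₁₂ F N θ p k) :
    ∀ k, k ≤ p.K → SLaw₁₂ F N θ p k :=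
  sLaw₁₂_all_of_rAssumedP244 F N θ p
    ((rOpLeaf₁₂_iff_rAssumedP244 F N θ p).1 (rOpLeaf_VOfRecord₁₂_of_absorbPresent F N θ p habs)) hT

/-- **THE (B)-FACE's FIRST CONJUNCT AT THE DATUM FROM (S1ᵀ) AND THE PRESENT-SEQUENCE ABSORPTION ALONG THE WINDOWED RUNS, general selector**: the two nodes'
printed products — N11's Theorem of p. 245 at the objects of record (`hT`) and N13's 𝐑-construction read at the objects of record as §3's socket hypothesis (`habs`,
[IV] Prop. 1 + [B16] (1.100)–(1.101), displayed, asked only on the windowed runs) — give `B16.Thm1Printed (datumOfRecord₁₂ F N θ h).C`.  Nothing asserted.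
[cite: Balaban1989LargeFieldII, Thm 1 p.355, (1.100)–(1.101) pp.390–391; Balaban1988Convergent, Thm 1 p.262, Theorem p.245, p.244; Balaban1989LargeFieldI, Prop. 1 p.177] -/
theorem thm1Printed_datumOfRecord₁₂_of_laws_of_absorbPresent {γ : ℝ} (hγ : 0 < γ)
    (habs : ∀ P : B12.RunParams, ((datumOfRecord₁₂ F N θ h).C P).flow.InInterval γ P.K → ∀ k, k < P.K →
      ∀ (t : SeqOfRecord F θ.ν θ.τ9.M (gOfRecord₁₀ F N θ.toStage9Params P) P.K (k + 1) → Sect2.TermValues (F.P P.K) (MatA N) (FluctV N) θ.τ9.M)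
      (Ek : SeqOfRecord F θ.ν θ.τ9.M (gOfRecord₁₀ F N θ.toStage9Params P) P.K (k + 1) → ℝ), Sect2.UniversalE t →
      (∀ s, Sect2.LawsT (sect2TowerOfRecord F N (FluctV N) P.K (settingOfRecord₁₂ F N θ P) (θ.Rz P.K) s (t s)) (settingOfRecord₁₂ F N θ P).lf
          (settingOfRecord₁₂ F N θ P).βc k ∧
        (slotsTOfRecord F N θ.ν θ.τ9 (EOfRecord₁₀ F N θ.toStage9Params) (wOfRecord₉ F N θ.toStage9Params) θ.ppSel P
            (gOfRecord₁₀ F N θ.toStage9Params P) (k + 1) s = 0 ∨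
          ∀ᵐ V ∂(fieldMeasure (F.P P.K) (k + 1) (SU N)), chiSeqOfRecord F N θ.ν θ.τ9.M (gOfRecord₁₀ F N θ.toStage9Params P) P.K (k + 1) s V ≠ 0 →
            slotsTOfRecord F N θ.ν θ.τ9 (EOfRecord₁₀ F N θ.toStage9Params) (wOfRecord₉ F N θ.toStage9Params) θ.ppSel P
                (gOfRecord₁₀ F N θ.toStage9Params P) (k + 1) s V
              = sect2Slot F N (FluctV N) P.K (settingOfRecord₁₂ F N θ P) (θ.Rz P.K) (WtOfRecord₁₂ F N θ P) s (t s) (Ek s)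
                  (UbgOfRecord₁₂ F N θ P (k + 1) s) V)) →
      ∃ (t' : SeqOfRecord F θ.ν θ.τ9.M (gOfRecord₁₀ F N θ.toStage9Params P) P.K (k + 1) → Sect2.TermValues (F.P P.K) (MatA N) (FluctV N) θ.τ9.M)
        (Ek' : SeqOfRecord F θ.ν θ.τ9.M (gOfRecord₁₀ F N θ.toStage9Params P) P.K (k + 1) → ℝ), Sect2.UniversalE t' ∧
        (∀ s, Sect2.LawsRT (sect2TowerOfRecord F N (FluctV N) P.K (settingOfRecord₁₂ F N θ P) (θ.Rz P.K) s (t' s)) (settingOfRecord₁₂ F N θ P).lf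
            (k + 1)) ∧
        ∀ s, s ∈ Set.range (θ.ppSel P (gOfRecord₁₀ F N θ.toStage9Params P) (k + 1)) →
          (slotsOfRecord F N θ.ν θ.τ9 (EOfRecord₁₀ F N θ.toStage9Params) (wOfRecord₉ F N θ.toStage9Params) θ.ppSel P
              (gOfRecord₁₀ F N θ.toStage9Params P) (k + 1) s = 0 ∨
            ∀ᵐ V ∂(fieldMeasure (F.P P.K) (k + 1) (SU N)), chiSeqOfRecord F N θ.ν θ.τ9.M (gOfRecord₁₀ F N θ.toStage9Params P) P.K (k + 1) s V ≠ 0 →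
              slotsOfRecord F N θ.ν θ.τ9 (EOfRecord₁₀ F N θ.toStage9Params) (wOfRecord₉ F N θ.toStage9Params) θ.ppSel P
                  (gOfRecord₁₀ F N θ.toStage9Params P) (k + 1) s V
                = sect2Slot F N (FluctV N) P.K (settingOfRecord₁₂ F N θ P) (θ.Rz P.K) (WtOfRecord₁₂ F N θ P) s (t' s) (Ek' s)
                    (UbgOfRecord₁₂ F N θ P (k + 1) s) V))
    (hT : ∀ P : B12.RunParams, ((datumOfRecord₁₂ F N θ h).C P).flow.InInterval γ P.K →
      ∀ k, k < P.K → SLaw₁₂ F N θ P k → TLaw₁₂ F N θ P k) :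
    B16.Thm1Printed (datumOfRecord₁₂ F N θ h).C :=
  thm1Printed_datumOfRecord₁₂_of_laws_rAssumedP244 F N θ h hγ hT
    (fun P hP => (rOpLeaf₁₂_iff_rAssumedP244 F N θ P).1 (rOpLeaf_VOfRecord₁₂_of_absorbPresent F N θ P (habs P hP)))

end Junction

/-! ## §5  (v1.1) THE SELECTOR OF RECORD: a selector that MOVES ONLY σ-ABSENT SEQUENCES moves only 𝐓-absent ones (node00-def-K0b's
`slotsTOfRecord_succ_eq_zero_of_forall_ne`) — §2 ∕ §4 with the «absent» clause DISCHARGED in print's own terms -/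

section SelectorOfRecord

variable (θ : Stage12Params F N) (p : B12.RunParams)

/-- **A SEQUENCE OUTSIDE THE IMAGE OF THE INDEX MAP `σOfRecord` HAS THE ZERO 𝐓-SLOT, at the Stage-12 slot families** (node00-def-K0b's
`slotsTOfRecord_succ_eq_zero_of_forall_ne` read at `θ`'s plugs `wOfRecord₉ = wOfRecord … θ.A₁ θ.ζ`: a pair `(Ω_{k+1}, Λ_{k+1})` no label `(P, Q, R, S)` produces carries
the step weight `0`, hence the transport of the zero integrand).  This is print's notion of an ABSENT term of (2.17)∕(2.18) — the one director-ym LINE №114 (α)'s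
selector of record is built on. [cite: Balaban1988Convergent, (2.17)–(2.18) p.257, (3.5) p.265, (3.20) p.269, (3.24)–(3.25) p.270] -/
theorem slotsTOfRecord₁₂_succ_eq_zero_of_forall_σ_ne (k : ℕ)
    (a : SeqOfRecord F θ.ν θ.τ9.M (gOfRecord₁₀ F N θ.toStage9Params p) p.K (k + 1))
    (ha : ∀ t : LbOfRecord F θ.ν p (gOfRecord₁₀ F N θ.toStage9Params p) k,
      σOfRecord F θ.ν θ.τ9.M p (gOfRecord₁₀ F N θ.toStage9Params p) k a.init t ≠ a) :
    slotsTOfRecord F N θ.ν θ.τ9 (EOfRecord₁₀ F N θ.toStage9Params) (wOfRecord₉ F N θ.toStage9Params) θ.ppSel p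
        (gOfRecord₁₀ F N θ.toStage9Params p) (k + 1) a = 0 :=
  slotsTOfRecord_succ_eq_zero_of_forall_ne F N θ.ν θ.A₁ θ.τ9 θ.ζ (EOfRecord₁₀ F N θ.toStage9Params) θ.ppSel p
    (gOfRecord₁₀ F N θ.toStage9Params p) k a ha

/-- **`TLaw₁₂ k → SLaw₁₂ (k+1)` FOR A SELECTOR OF RECORD**: idempotent at level `k+1` and MOVING ONLY σ-ABSENT SEQUENCES (every `a` with `sel a ≠ a` lies outside the
image of `σOfRecord … a.init ·`) — §2's `sLaw₁₂_succ_of_tLaw₁₂_of_idem_of_absent` with its «moved ⇒ zero 𝐓-slot» clause DISCHARGED by K0b's lemma.  The shape of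
the re-pinned K0′ witness's selector (director-ym LINE №114 (α): «range = the PRESENT sequences»), stated for EVERY `θ`.
[cite: Balaban1988Convergent, §2 p.262, Thm 2 p.263, (3.24)–(3.25) p.270; Balaban1989LargeFieldI, (0.3) p.176, p.177 (i)–(ii)] -/
theorem sLaw₁₂_succ_of_tLaw₁₂_of_idem_of_moveAbsent (h : θ.Provisos₁₂ F N) (hθ : θ.Admissible F N) (hκ : 0 ≤ θ.s2.lf.κ)
    (hE₀ : 0 ≤ θ.s2.lf.E₀) (hB₀ : 0 ≤ θ.s2.lf.B₀) (k : ℕ) (hk : k < p.K) (hg : 0 ≤ gOfRecord₁₀ F N θ.toStage9Params p (k + 1))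
    (hidem : ∀ a, θ.ppSel p (gOfRecord₁₀ F N θ.toStage9Params p) (k + 1) (θ.ppSel p (gOfRecord₁₀ F N θ.toStage9Params p) (k + 1) a)
      = θ.ppSel p (gOfRecord₁₀ F N θ.toStage9Params p) (k + 1) a)
    (hmove : ∀ a, θ.ppSel p (gOfRecord₁₀ F N θ.toStage9Params p) (k + 1) a ≠ a →
      ∀ t : LbOfRecord F θ.ν p (gOfRecord₁₀ F N θ.toStage9Params p) k,
        σOfRecord F θ.ν θ.τ9.M p (gOfRecord₁₀ F N θ.toStage9Params p) k a.init t ≠ a)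
    (hT : TLaw₁₂ F N θ p k) : SLaw₁₂ F N θ p (k + 1) :=
  sLaw₁₂_succ_of_tLaw₁₂_of_idem_of_absent F N θ p h hθ hκ hE₀ hB₀ k hk hg hidem
    (fun a hne => slotsTOfRecord₁₂_succ_eq_zero_of_forall_σ_ne F N θ p k a (hmove a hne)) hT

/-- **★ THE 𝐑-LEAF OF RECORD AT STAGE 12 FOR A SELECTOR OF RECORD** (idempotent, moving only σ-absent sequences, at every level `k < K`): under the provisos,
admissibility, the displayed signs and `0 ≤ g_{k+1}`, `ROpLeaf (VOfRecord₁₂ F N θ p)`. [cite: Balaban1988Convergent, p.244, Thm 2 p.263; Balaban1989LargeFieldI, (0.3) p.176, p.177 (i)–(ii); Balaban1989LargeFieldII, Thm 1 p.355 (not exercised on this branch)] -/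
theorem rOpLeaf_VOfRecord₁₂_of_idem_of_moveAbsent (h : θ.Provisos₁₂ F N) (hθ : θ.Admissible F N) (hκ : 0 ≤ θ.s2.lf.κ) (hE₀ : 0 ≤ θ.s2.lf.E₀)
    (hB₀ : 0 ≤ θ.s2.lf.B₀) (hg : ∀ k, k < p.K → 0 ≤ gOfRecord₁₀ F N θ.toStage9Params p (k + 1))
    (hidem : ∀ k, k < p.K → ∀ a, θ.ppSel p (gOfRecord₁₀ F N θ.toStage9Params p) (k + 1)
      (θ.ppSel p (gOfRecord₁₀ F N θ.toStage9Params p) (k + 1) a) = θ.ppSel p (gOfRecord₁₀ F N θ.toStage9Params p) (k + 1) a)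
    (hmove : ∀ k, k < p.K → ∀ a, θ.ppSel p (gOfRecord₁₀ F N θ.toStage9Params p) (k + 1) a ≠ a →
      ∀ t : LbOfRecord F θ.ν p (gOfRecord₁₀ F N θ.toStage9Params p) k,
        σOfRecord F θ.ν θ.τ9.M p (gOfRecord₁₀ F N θ.toStage9Params p) k a.init t ≠ a) :
    ROpLeaf (VOfRecord₁₂ F N θ p) :=
  rOpLeaf_VOfRecord₁₂_of_idem_of_absent F N θ p h hθ hκ hE₀ hB₀ hg hidem
    (fun k hk a hne => slotsTOfRecord₁₂_succ_eq_zero_of_forall_σ_ne F N θ p k a (hmove k hk a hne))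

/-- … with `0 ≤ g_{k+1}` DISCHARGED by the coupling window of the run at the datum of record. [cite: Balaban1989LargeFieldII, Thm 1 p.355; Balaban1987RG1, (0.17)–(0.20) pp.255–256] -/
theorem rOpLeaf_VOfRecord₁₂_of_idem_of_moveAbsent_of_inInterval (h : θ.Provisos₁₂ F N) (hθ : θ.Admissible F N) (hκ : 0 ≤ θ.s2.lf.κ)
    (hE₀ : 0 ≤ θ.s2.lf.E₀) (hB₀ : 0 ≤ θ.s2.lf.B₀) {γ : ℝ} (hsc : ((datumOfRecord₁₂ F N θ h).C p).flow.InInterval γ p.K)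
    (hidem : ∀ k, k < p.K → ∀ a, θ.ppSel p (gOfRecord₁₀ F N θ.toStage9Params p) (k + 1)
      (θ.ppSel p (gOfRecord₁₀ F N θ.toStage9Params p) (k + 1) a) = θ.ppSel p (gOfRecord₁₀ F N θ.toStage9Params p) (k + 1) a)
    (hmove : ∀ k, k < p.K → ∀ a, θ.ppSel p (gOfRecord₁₀ F N θ.toStage9Params p) (k + 1) a ≠ a →
      ∀ t : LbOfRecord F θ.ν p (gOfRecord₁₀ F N θ.toStage9Params p) k,
        σOfRecord F θ.ν θ.τ9.M p (gOfRecord₁₀ F N θ.toStage9Params p) k a.init t ≠ a) :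
    ROpLeaf (VOfRecord₁₂ F N θ p) :=
  rOpLeaf_VOfRecord₁₂_of_idem_of_absent_of_inInterval F N θ p h hθ hκ hE₀ hB₀ hsc hidem
    (fun k hk a hne => slotsTOfRecord₁₂_succ_eq_zero_of_forall_σ_ne F N θ p k a (hmove k hk a hne))

/-- **★ THEOREM 1 [III] AT THE STAGE-12 OBJECTS OF RECORD FROM (S1ᵀ) ALONE, FOR A SELECTOR OF RECORD** (§4's `sLaw₁₂_all_of_thmP245_of_idem_of_absent` with the
«absent» clause in print's terms). [cite: Balaban1988Convergent, Thm 1 p.262; Theorem p.245; p.244; Balaban1989LargeFieldI, (0.3) p.176, p.177 (i)–(ii)] -/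
theorem sLaw₁₂_all_of_thmP245_of_idem_of_moveAbsent (h : θ.Provisos₁₂ F N) (hθ : θ.Admissible F N) (hκ : 0 ≤ θ.s2.lf.κ) (hE₀ : 0 ≤ θ.s2.lf.E₀)
    (hB₀ : 0 ≤ θ.s2.lf.B₀) (hg : ∀ k, k < p.K → 0 ≤ gOfRecord₁₀ F N θ.toStage9Params p (k + 1))
    (hidem : ∀ k, k < p.K → ∀ a, θ.ppSel p (gOfRecord₁₀ F N θ.toStage9Params p) (k + 1)
      (θ.ppSel p (gOfRecord₁₀ F N θ.toStage9Params p) (k + 1) a) = θ.ppSel p (gOfRecord₁₀ F N θ.toStage9Params p) (k + 1) a)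
    (hmove : ∀ k, k < p.K → ∀ a, θ.ppSel p (gOfRecord₁₀ F N θ.toStage9Params p) (k + 1) a ≠ a →
      ∀ t : LbOfRecord F θ.ν p (gOfRecord₁₀ F N θ.toStage9Params p) k,
        σOfRecord F θ.ν θ.τ9.M p (gOfRecord₁₀ F N θ.toStage9Params p) k a.init t ≠ a)
    (hT : ∀ k, k < p.K → SLaw₁₂ F N θ p k → TLaw₁₂ F N θ p k) :
    ∀ k, k ≤ p.K → SLaw₁₂ F N θ p k :=
  sLaw₁₂_all_of_thmP245_of_idem_of_absent F N θ p h hθ hκ hE₀ hB₀ hg hidem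
    (fun k hk a hne => slotsTOfRecord₁₂_succ_eq_zero_of_forall_σ_ne F N θ p k a (hmove k hk a hne)) hT

variable (w : WorldP) (h : θ.Provisos₁₂ F N)

/-- **N11 · `Dag.B14_main (leavesP w P)` AT A STAGE-12 WORLD FOR A SELECTOR OF RECORD — ONE DISPLAYED SLOT, NO 𝐑-READING HYPOTHESIS** (§4's
`b14_main_at_record₁₂_of_idem_of_absent` with the «absent» clause in print's terms: moved ⇒ outside the image of `σOfRecord`).
[cite: Balaban1988Convergent, Thm 1 p.262; Theorem p.245; p.244; (2.6) p.255] -/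
theorem b14_main_at_record₁₂_of_idem_of_moveAbsent (hC : w.C = (datumOfRecord₁₂ F N θ h).C) (hθ : θ.Admissible F N) (hκ : 0 ≤ θ.s2.lf.κ)
    (hE₀ : 0 ≤ θ.s2.lf.E₀) (hB₀ : 0 ≤ θ.s2.lf.B₀)
    (hidem : ∀ k, k < p.K → ∀ a, θ.ppSel p (gOfRecord₁₀ F N θ.toStage9Params p) (k + 1)
      (θ.ppSel p (gOfRecord₁₀ F N θ.toStage9Params p) (k + 1) a) = θ.ppSel p (gOfRecord₁₀ F N θ.toStage9Params p) (k + 1) a)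
    (hmove : ∀ k, k < p.K → ∀ a, θ.ppSel p (gOfRecord₁₀ F N θ.toStage9Params p) (k + 1) a ≠ a →
      ∀ t : LbOfRecord F θ.ν p (gOfRecord₁₀ F N θ.toStage9Params p) k,
        σOfRecord F θ.ν θ.τ9.M p (gOfRecord₁₀ F N θ.toStage9Params p) k a.init t ≠ a)
    (hT : (leavesP w p).b7 → (leavesP w p).b8 → (leavesP w p).b9 → (leavesP w p).b10 → (leavesP w p).b11 →
      (leavesP w p).smallCouplings → (leavesP w p).smallFieldInductive → (leavesP w p).flowControl →
        ∀ k, k < p.K → SLaw₁₂ F N θ p k → TLaw₁₂ F N θ p k) :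
    Dag.B14_main (leavesP w p) :=
  b14_main_at_record₁₂_of_idem_of_absent F N θ p w h hC hθ hκ hE₀ hB₀ hidem
    (fun k hk a hne => slotsTOfRecord₁₂_succ_eq_zero_of_forall_σ_ne F N θ p k a (hmove k hk a hne)) hT

/-- **★ THE ROUTE's K1′ (B)-FACE FIRST CONJUNCT `B16.Thm1Printed (datumOfRecord₁₂ F N θ h).C` FROM THE THEOREM OF p. 245 ALONG THE WINDOWED RUNS ALONE, FOR A
SELECTOR OF RECORD** (§4's `thm1Printed_datumOfRecord₁₂_of_laws_of_idem_of_absent` with the «absent» clause in print's terms).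
[cite: Balaban1989LargeFieldII, Thm 1 p.355; Balaban1988Convergent, Thm 1 p.262; Theorem p.245; p.244] -/
theorem thm1Printed_datumOfRecord₁₂_of_laws_of_idem_of_moveAbsent (hθ : θ.Admissible F N) (hκ : 0 ≤ θ.s2.lf.κ) (hE₀ : 0 ≤ θ.s2.lf.E₀)
    (hB₀ : 0 ≤ θ.s2.lf.B₀) {γ : ℝ} (hγ : 0 < γ)
    (hidem : ∀ P : B12.RunParams, ((datumOfRecord₁₂ F N θ h).C P).flow.InInterval γ P.K →
      ∀ k, k < P.K → ∀ a, θ.ppSel P (gOfRecord₁₀ F N θ.toStage9Params P) (k + 1)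
        (θ.ppSel P (gOfRecord₁₀ F N θ.toStage9Params P) (k + 1) a) = θ.ppSel P (gOfRecord₁₀ F N θ.toStage9Params P) (k + 1) a)
    (hmove : ∀ P : B12.RunParams, ((datumOfRecord₁₂ F N θ h).C P).flow.InInterval γ P.K →
      ∀ k, k < P.K → ∀ a, θ.ppSel P (gOfRecord₁₀ F N θ.toStage9Params P) (k + 1) a ≠ a →
        ∀ t : LbOfRecord F θ.ν P (gOfRecord₁₀ F N θ.toStage9Params P) k,
          σOfRecord F θ.ν θ.τ9.M P (gOfRecord₁₀ F N θ.toStage9Params P) k a.init t ≠ a)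
    (hT : ∀ P : B12.RunParams, ((datumOfRecord₁₂ F N θ h).C P).flow.InInterval γ P.K →
      ∀ k, k < P.K → SLaw₁₂ F N θ P k → TLaw₁₂ F N θ P k) :
    B16.Thm1Printed (datumOfRecord₁₂ F N θ h).C :=
  thm1Printed_datumOfRecord₁₂_of_laws_of_idem_of_absent F N θ h hθ hκ hE₀ hB₀ hγ hidem
    (fun P hP k hk a hne => slotsTOfRecord₁₂_succ_eq_zero_of_forall_σ_ne F N θ P k a (hmove P hP k hk a hne)) hT

end SelectorOfRecord

end Literature.MathematicalPhysics.QuantumFieldTheory.Balaban1983to89.B16RLeafRecord12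

end
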